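import Mathlib.Analysis.SpecialFunctions.Log.Summable
import Literature.NumberTheory.ConnesConsani2021.ExponentialBasis
import Literature.NumberTheory.ConnesConsani2021.MainInequalityAssembly
import HarnessLib

/-!
# Connes–Consani 2021, §6.3–6.7: the printed numerical inputs of the proof of Theorem 6.11
# AS PRINTED (Fact 6.1, Lemma 6.4, Fact 6.5, Lemma 6.6, Remark 6.7, Lemma 6.8, Remark 6.12),
# and their kernel-checked hand-over to `MainInequalityAssembly`

A. Connes, C. Consani, *Weil positivity and trace formula, the archimedean place*, Selecta Math.
(N.S.) 27 (2021), Paper No. 77 = arXiv:2006.13771 [bib: `ConnesConsani2021`]; §6.3 Fact 6.1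
(= arXiv Fact 34, p. 24), §6.5 Lemma 6.4 (= Lemma 37) and display (normpsi), Fact 6.5 (= Fact 38,
p. 25), §6.6 Lemma 6.6 (= Lemma 39, p. 25), display (opTeigen) and Remark 6.7 (= Remark 40, p. 26),
Lemma 6.8 (= Lemma 41, pp. 26–27), §6.7 display (spectral0) (p. 28) and Remark 6.12 (= Remark 45,
p. 29).  Locators `p. N` are the arXiv chunks `pNNNN` of the held text; the statements were typed from
the arXiv TeX source (`weil-compo.tex`, labels `approximation`, `supportf`, `factnum`, `projPn`,
`remevenodd`, `lemspec`, `remlowc`).  Cell `rh-crit` (C1 Connes–Consani corpus), seat t7.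

FRAMING (cell rule, line 1 of every docstring): these are RH-FREE corpus statements about one
compact operator on `L²([−½log 2, ½log 2])`; the numerical ones are NUMERICAL-IN-PRINT (floating
point outputs of the source, "up to some computational imprecision which we evaluate later", p. 28;
no interval arithmetic is claimed in print and none is added here); nothing in this file bears on the
truth of RH.  WHAT THIS FILE IS NOT: a certification of the printed numbers; a discharge of
`WeilArchPositivity_soninTrace[_fine]`; a statement about RH.

**What is printed and how it is typed.**  The proof of Theorem 6.11 consumes (RIGOUR-MAP (N2)–(N4)):
* Fact 6.1: "`2∫₀^{log 2} |τ(λ,α,d,m)(x) − χ(x)| dx ∼ 0.00122`" (`m = 1732`, `χ(x) = (Qε)(e^{|x|})/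
  (2ε′(1₊))`, `τ` the trigonometric sum (approx0)) — `CC2021_fact_6_1`;
* Lemma 6.4: the vector `ψ = L⁻¹ĥ(x/L)` (`h(z) = ∏_{n>0}(1 − z²/α_n²)`, `α_n = n` for `n > m`) satisfies
  `Tψ = λψ`, `⟨ξ_0|ψ⟩ = L^{−1/2}`, `⟨ξ_{α_n}|ψ⟩ = 0 ∀ n ≠ 0` — the objects `hProd`, `ccPsi`, `ccZeta`
  (`ζ = ψ/‖ψ‖`), the PROVED parts (`inner_expVector_zero_ccPsi`, `norm_ccPsi_sq` = (normpsi),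
  `inner_expVector_intCast_ccPsi_of_lt`, and `Tψ = λψ` GIVEN the orthogonality: `opT_ccPsi`) and the
  orthogonality to `ξ_{±α_n}`, `1 ≤ n ≤ m`, as the exact named fact `CC2021_lemma_6_4`;
* Fact 6.5: "`⟨ξ_0|ζ⟩ ∼ 0.94865`" — `CC2021_fact_6_5`, with the exact identity `⟨ξ_0|ζ⟩ = 1/‖h‖₂` PROVED
  (`inner_expVector_zero_ccZeta`);
* Lemma 6.6 (the `(log Γ)''` closed form of `‖ξ_α − P(n)ξ_α‖²`) — exact named fact `CC2021_lemma_6_6`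
  over the trigamma series `trigammaSum` (its Parseval half is `hasSum_sinc_sq_norm_sub_proj`);
* Remark 6.7 (parity symmetry `M_{−i,−j} = M_{i,j}`) — PROVED for `T` itself
  (`inner_expVector_neg_opT_expVector_neg`, `involution_apply_eq_or_eq_neg_of_simple`);
* Lemma 6.8: the explicit quantities `ε(j,N)`, `e(N)`, `e′(N)`, `ε(N)`, `ε₁(N)` of (ii) as definitions
  and (iii) "`Spec T ⊂ {λ_max} ∪ [−2, λ₂]`, `λ₂ ≤ 0.772216`" in the operative form of §6.7's spectral
  decomposition — `CC2021_lemma_6_8_iii`; the similarity statement (i) and the perturbation statement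
  (ii) live on `ℓ²(ℤ)` (infinite matrices `A`, `J`) and are NOT typed beyond their quantities;
* Remark 6.12: "the best constant `c` fulfilling (maininequ) is such that `13 < c < 17`" — the lower
  half as `CC2021_rem_6_12` (companion of the tree's `WeilArchPositivity_soninTrace_fine` = `∃ c < 17`).
The printed constants `λ_max = 1.05158`, `m = 1732`, `ε₁ = 0.00122`, `λ₂ ≤ 0.772216`,
`⟨ξ_0|ζ⟩ ≃ 0.94865`, `a = 0.064` appear as literals where the proof of Lemma 6.10 uses them; the angles
`α_n` and coefficients `d(n)` (`n ≤ 1732`; supplementary tables of the source, pp. 23–24, "can be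
downloaded" — NOT printed) are parameters `α d : ℕ → ℝ`, and the density of `E₊` (in print `ε∘exp`,
§5) is the parameter `G` exactly as in `MainInequalityAssembly`.  Every definition takes the window
`I = [a, b]` abstractly (CC: `a = −½log 2`, `b = ½log 2`), as the rest of this folder does; CC's
window is written out only in theorem statements.

**The hand-over (PROVED).**  `opIneq_of_section6`: Fact 6.1 + Lemma 6.4 + Fact 6.5 + Lemma 6.8 (iii)
⇒ the sign-free operator inequality (H-op) of `MainInequalityAssembly` with `a₀ = 0.064`, through
`opIneq_of_selfAdjoint_eigenvector` with `T = opT a b 1.05158 α d 1732`, `η = ζ`, `λ_max = 1.05158`,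
`λ₂ = 0.772216`, `ε₁ = 0.00122` (links: `inner_opT_comm` = hsa, `opT_ccZeta` = heig,
`norm_windowOp_sub_opT_le_of_fact_6_1` = hKT via Lemma 6.3, `eps1_le_rankOneGap_of_fact_6_5` = hε via
`printedConstants_posconds` and the monotonicity `rankOneGap_mono`); whence
`weilArchPositivity_soninTrace_fine_of_section6` / `weilArchPositivity_soninTrace_of_section6`:
eq. (4) / Theorem 1 from (A) Theorem 4.7's weak trace formula, (B) the `C²` density with
`G′(0) = e′ > 0` and `8·0.064·e′/log 2 < 17`, (C) the four §6 inputs of this file.  New named facts: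
2 exact and dischargeable (`CC2021_lemma_6_4`, `CC2021_lemma_6_6`) and 1 NUMERICAL-IN-PRINT closed
(`CC2021_rem_6_12`); the three NUMERICAL-IN-PRINT inputs `CC2021_fact_6_1`/`_6_5`/`_lemma_6_8_iii`
are predicates on the data; 0 discharged.  Consistency note recorded at `CC2021_fact_6_5`
(`0.94865` vs `1/1.05143 = 0.95109`).
-/

noncomputable section

open MeasureTheory Set Complex Filter Submodule
open scoped ComplexConjugate InnerProductSpace Real

namespace Literature.NumberTheory.ConnesConsani2021

open Literature.NumberTheory.LFunctions

variable {a b : ℝ}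

/-! ## CC's conventions on the angles `α_n` and the function `h` of §6.5 -/

/-- RH-FREE. **CC's convention on the angles** (Lemma 6.3 p. 24: "for `n > m`, we set `α_n = n` and
`d(n) = 1`"; §6.5 p. 25: "using the conventions of Lemma 6.3: i.e. for `n > m` we set `α_n = n`"):
the angle sequence `α` extended by `α̃_n = n` beyond `m`.  The angles `α_1, …, α_m` themselves
(`m = 1732`, `α_1 = 1.33371, α_2 = 2.10964, …`, table (tableangles) p. 23, "precise numerical values
… can be downloaded", p. 23) are supplementary DATA of the source and enter this file as a parameter
`α : ℕ → ℝ`. [cite: ConnesConsani2021, Lemma 6.3 §6.4 p. 24; §6.2 table (tableangles) p. 23] -/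
def ccAngle (α : ℕ → ℝ) (m n : ℕ) : ℝ := if n ≤ m then α n else n

/-- `α̃_n = α_n` for `n ≤ m`. [cite: ConnesConsani2021, Lemma 6.3 §6.4 p. 24] -/
theorem ccAngle_of_le {α : ℕ → ℝ} {m n : ℕ} (h : n ≤ m) : ccAngle α m n = α n := if_pos h

/-- `α̃_n = n` for `n > m`. [cite: ConnesConsani2021, Lemma 6.3 §6.4 p. 24] -/
theorem ccAngle_of_lt {α : ℕ → ℝ} {m n : ℕ} (h : m < n) : ccAngle α m n = n := if_neg (not_le.2 h)

/-- RH-FREE. The `n`-th factor `1 − z²/α̃_n²` (`n ≥ 1`; index shifted by one) of CC's infinite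
product `h`. [cite: ConnesConsani2021, §6.5 p. 25 (definition of `h`)] -/
def hFactor (α : ℕ → ℝ) (m : ℕ) (z : ℝ) (n : ℕ) : ℝ := 1 - z ^ 2 / ccAngle α m (n + 1) ^ 2

/-- RH-FREE. **CC's function `h` of §6.5** (p. 25): "`h(z) := ∏_{n>0} (1 − z²/α_n²)`, which is
convergent likewise the product defining `sin(πz)/(πz)` and is, by construction, the product of
`sin(πz)/(πz)` by a rational fraction whose role is to replace the zeros `±n` for `n ∈ {1,…,m}`, by
the `±α_n`" (with the convention `α_n = n` for `n > m`), as an unconditional infinite product.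
[cite: ConnesConsani2021, §6.5 p. 25 (definition of `h`)] -/
def hProd (α : ℕ → ℝ) (m : ℕ) (z : ℝ) : ℝ := ∏' n : ℕ, hFactor α m z n

/-- `h(0) = 1` (all factors equal `1`; "`h(1) = 1 ⇒ ⟨ξ_0|ψ⟩ = (log 2)^{−1/2}`" in the proof of
Lemma 6.4 uses this value at the frequency `0`). PROVED. [cite: ConnesConsani2021, Lemma 6.4 §6.5 p. 25 (proof)] -/
theorem hProd_zero (α : ℕ → ℝ) (m : ℕ) : hProd α m 0 = 1 := by
  simp [hProd, hFactor]

/-- `h` is even. PROVED. [cite: ConnesConsani2021, §6.5 p. 25] -/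
theorem hProd_neg (α : ℕ → ℝ) (m : ℕ) (z : ℝ) : hProd α m (-z) = hProd α m z := by
  simp [hProd, hFactor]

/-- **`h(α_n) = 0` for `1 ≤ n ≤ m`** (the factor `n` vanishes; `α_n ≠ 0`) — "`h(α_n) = 0`" in the
proof of Lemma 6.4. PROVED. [cite: ConnesConsani2021, Lemma 6.4 §6.5 p. 25 (proof)] -/
theorem hProd_angle {α : ℕ → ℝ} {m n : ℕ} (h1 : 1 ≤ n) (hn : n ≤ m) (hα : α n ≠ 0) :
    hProd α m (α n) = 0 := by
  refine tprod_of_exists_eq_zero ⟨n - 1, ?_⟩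
  have e : n - 1 + 1 = n := Nat.sub_add_cancel h1
  rw [hFactor, e, ccAngle_of_le hn, div_self (pow_ne_zero 2 hα), sub_self]

/-- **`h(k) = 0` for every integer `k > m`** (the factor `n = k` is `1 − k²/k²`, `α_k = k` by
convention) — so that `ψ ⊥ ξ_k` for `|k| > m` ("`⟨ξ_{α_n}|ψ⟩ = 0 ∀ n ≠ 0`" with `α_n = n`). PROVED.
[cite: ConnesConsani2021, Lemma 6.4 §6.5 p. 25] -/
theorem hProd_natCast_of_lt {α : ℕ → ℝ} {m k : ℕ} (hk : m < k) : hProd α m k = 0 := by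
  refine tprod_of_exists_eq_zero ⟨k - 1, ?_⟩
  have e : k - 1 + 1 = k := Nat.sub_add_cancel (Nat.one_le_of_lt hk)
  have hk0 : (k : ℝ) ≠ 0 := Nat.cast_ne_zero.2 (Nat.ne_zero_of_lt hk)
  rw [hFactor, e, ccAngle_of_lt hk, div_self (pow_ne_zero 2 hk0), sub_self]

/-- `h(k) = 0` for an integer `k` with `|k| > m`. PROVED. [cite: ConnesConsani2021, Lemma 6.4 §6.5 p. 25] -/
theorem hProd_intCast_of_lt {α : ℕ → ℝ} {m : ℕ} {k : ℤ} (hk : (m : ℤ) < |k|) :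
    hProd α m k = 0 := by
  rcases le_or_gt 0 k with h | h
  · lift k to ℕ using h
    rw [Int.cast_natCast]
    exact hProd_natCast_of_lt (by rw [Nat.abs_cast] at hk; exact_mod_cast hk)
  · obtain ⟨j, rfl⟩ : ∃ j : ℕ, k = -(j : ℤ) := ⟨k.natAbs, by omega⟩
    rw [Int.cast_neg, Int.cast_natCast, hProd_neg]
    refine hProd_natCast_of_lt ?_
    rw [abs_neg, Nat.abs_cast] at hk
    exact_mod_cast hk

/-! ## The eigenvector `ψ` of Lemma 6.4 and its normalization `ζ` (Fact 6.5) -/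

/-- RH-FREE. **CC's eigenvector `ψ` of Lemma 6.4** (= arXiv Lemma 37, §6.5 p. 25), on the window
`I = [a, b]`, `L = b − a` (CC: `I = [−½log 2, ½log 2]`): in print `ψ(x) = L⁻¹ ĥ(x/L)`, the Fourier
transform of `h(zL)`, shown there to be supported in `I`; its coefficients on the orthonormal basis
`(ξ_k)_{k∈ℤ}` of `𝓗 = L²(I)` are `⟨ξ_k|ψ⟩ = L^{−1/2} ∫ ĥ(y) e^{−2πiky} dy = L^{−1/2} h(k)` (the
Fourier-inversion display of the proof of Lemma 6.4, p. 25, at the integer frequency `k`), and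
`h(k) = 0` for `|k| > m` (`hProd_intCast_of_lt`).  We therefore DEFINE
`ψ := L^{−1/2} Σ_{|k| ≤ m} h(k) ξ_k ∈ L²(I)` — the same vector, "since the vectors `ξ_n` form an
orthonormal basis of `𝓗`" (`ExponentialBasis`); the Paley–Wiener step `supp ĥ ⊆ [−½, ½]` is
thereby built in rather than re-proved. [cite: ConnesConsani2021, Lemma 6.4 §6.5 p. 25] -/
def ccPsi (a b : ℝ) (α : ℕ → ℝ) (m : ℕ) : Lp ℂ 2 (volume.restrict (Icc a b)) :=
  (((Real.sqrt (b - a))⁻¹ : ℝ) : ℂ) •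
    ∑ k ∈ Finset.Icc (-(m : ℤ)) m, ((hProd α m k : ℝ) : ℂ) • expVector a b k

/-- Coefficient extraction against an orthonormal family, inside or outside the summation set.
[folklore] -/
private theorem inner_right_sum_ite {ι E' : Type*} [NormedAddCommGroup E']
    [InnerProductSpace ℂ E'] [DecidableEq ι] {v : ι → E'} (hv : Orthonormal ℂ v) (l : ι → ℂ)
    (s : Finset ι) (i : ι) :
    ⟪v i, ∑ j ∈ s, l j • v j⟫_ℂ = if i ∈ s then l i else 0 := by
  split_ifs with hi
  · exact hv.inner_right_sum l hi
  · rw [inner_sum]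
    refine Finset.sum_eq_zero fun j hj ↦ ?_
    have hij : i ≠ j := fun h ↦ hi (h ▸ hj)
    rw [inner_smul_right, orthonormal_iff_ite.1 hv, if_neg hij, mul_zero]

/-- **`⟨ξ_k|ψ⟩ = L^{−1/2} h(k)` for every `k ∈ ℤ`** (proof of Lemma 6.4, Fourier inversion at
integer frequencies; for `|k| > m` both sides vanish). PROVED.
[cite: ConnesConsani2021, Lemma 6.4 §6.5 p. 25 (proof)] -/
theorem inner_expVector_intCast_ccPsi (hab : a < b) (α : ℕ → ℝ) (m : ℕ) (k : ℤ) :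
    ⟪expVector a b k, ccPsi a b α m⟫_ℂ
      = (((Real.sqrt (b - a))⁻¹ : ℝ) : ℂ) * ((hProd α m k : ℝ) : ℂ) := by
  classical
  rw [ccPsi, inner_smul_right,
    inner_right_sum_ite (orthonormal_expVector_intCast hab) (fun j : ℤ ↦ ((hProd α m j : ℝ) : ℂ))]
  split_ifs with hk
  · rfl
  · rw [Finset.mem_Icc, ← abs_le, not_le] at hk
    rw [hProd_intCast_of_lt hk, Complex.ofReal_zero, mul_zero]

/-- **(psiortho), first part: `⟨ξ_0|ψ⟩ = L^{−1/2}`** ("since `h(1) = 1 ⇒ ⟨ξ_0|ψ⟩ = (log 2)^{−1/2}`",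
proof of Lemma 6.4 — the value `h(0) = 1`). PROVED.
[cite: ConnesConsani2021, Lemma 6.4 §6.5 p. 25, display (psiortho)] -/
theorem inner_expVector_zero_ccPsi (hab : a < b) (α : ℕ → ℝ) (m : ℕ) :
    ⟪expVector a b 0, ccPsi a b α m⟫_ℂ = (((Real.sqrt (b - a))⁻¹ : ℝ) : ℂ) := by
  have h := inner_expVector_intCast_ccPsi hab α m 0
  rw [Int.cast_zero, hProd_zero, Complex.ofReal_one, mul_one] at h
  exact h

/-- `ψ ⊥ ξ_k` for every integer `|k| > m` — "`⟨ξ_{α_n}|ψ⟩ = 0 ∀ n ≠ 0`" for `|n| > m`, where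
`α_n = n` by convention. PROVED. [cite: ConnesConsani2021, Lemma 6.4 §6.5 p. 25, display (psiortho)] -/
theorem inner_expVector_intCast_ccPsi_of_lt (hab : a < b) (α : ℕ → ℝ) {m : ℕ} {k : ℤ}
    (hk : (m : ℤ) < |k|) : ⟪expVector a b k, ccPsi a b α m⟫_ℂ = 0 := by
  rw [inner_expVector_intCast_ccPsi hab, hProd_intCast_of_lt hk, Complex.ofReal_zero, mul_zero]

/-- **(normpsi) as an identity: `‖ψ‖² = L⁻¹ Σ_{|k|≤m} h(k)²`** ("`‖ψ‖₂ = (log 2)^{−1/2}‖h‖₂`",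
p. 25, with `‖h‖₂² = Σ_{k∈ℤ} h(k)²` by Parseval for the band-limited `h`; printed value
`‖h‖₂ ∼ 1.05143` for `m = 1732`, NUMERICAL IN PRINT and not asserted here). PROVED.
[cite: ConnesConsani2021, §6.5 p. 25, display (normpsi)] -/
theorem norm_ccPsi_sq (hab : a < b) (α : ℕ → ℝ) (m : ℕ) :
    ‖ccPsi a b α m‖ ^ 2 = (b - a)⁻¹ * ∑ k ∈ Finset.Icc (-(m : ℤ)) m, hProd α m k ^ 2 := by
  have hba : 0 < b - a := sub_pos.2 hab
  have hon := orthonormal_expVector_intCast hab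
  have h1 : ((‖ccPsi a b α m‖ : ℂ) ^ 2) = ⟪ccPsi a b α m, ccPsi a b α m⟫_ℂ :=
    (inner_self_eq_norm_sq_to_K (𝕜 := ℂ) (ccPsi a b α m)).symm
  rw [ccPsi, inner_smul_left, inner_smul_right, hon.inner_sum] at h1
  have h2 : ∑ i ∈ Finset.Icc (-(m : ℤ)) m,
      conj (((hProd α m i : ℝ) : ℂ)) * ((hProd α m i : ℝ) : ℂ)
        = ((∑ k ∈ Finset.Icc (-(m : ℤ)) m, hProd α m k ^ 2 : ℝ) : ℂ) := by
    rw [Complex.ofReal_sum]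
    refine Finset.sum_congr rfl fun i _ ↦ ?_
    rw [Complex.conj_ofReal, ← Complex.ofReal_mul, ← sq]
  rw [h2, Complex.conj_ofReal, ← mul_assoc, ← Complex.ofReal_mul, ← Complex.ofReal_mul,
    ← mul_inv, Real.mul_self_sqrt hba.le] at h1
  exact_mod_cast h1

/-- `ψ ≠ 0` (`⟨ξ_0|ψ⟩ = L^{−1/2} ≠ 0`). PROVED. [cite: ConnesConsani2021, Lemma 6.4 §6.5 p. 25] -/
theorem ccPsi_ne_zero (hab : a < b) (α : ℕ → ℝ) (m : ℕ) : ccPsi a b α m ≠ 0 := by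
  intro h
  have h0 := inner_expVector_zero_ccPsi hab α m
  rw [h, inner_zero_right] at h0
  have : ((Real.sqrt (b - a))⁻¹ : ℝ) = 0 := by exact_mod_cast h0.symm
  exact (inv_ne_zero (Real.sqrt_pos.2 (sub_pos.2 hab)).ne') this

/-- RH-FREE. **CC's unit vector `ζ := ψ/‖ψ‖₂`** (Fact 6.5 p. 25: "where `ζ(x) = ψ(x)/‖ψ‖₂`"; it is
the `η` of the spectral decomposition `T = λ_max|η⟩⟨η| + R` of §6.7 p. 28 and the `φ = ζ` of the
proof of Lemma 6.10). [cite: ConnesConsani2021, Fact 6.5 §6.5 p. 25; §6.7 p. 28] -/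
def ccZeta (a b : ℝ) (α : ℕ → ℝ) (m : ℕ) : Lp ℂ 2 (volume.restrict (Icc a b)) :=
  ((‖ccPsi a b α m‖⁻¹ : ℝ) : ℂ) • ccPsi a b α m

/-- `‖ζ‖ = 1`. PROVED. [cite: ConnesConsani2021, Fact 6.5 §6.5 p. 25] -/
theorem norm_ccZeta (hab : a < b) (α : ℕ → ℝ) (m : ℕ) : ‖ccZeta a b α m‖ = 1 := by
  rw [ccZeta, norm_smul, Complex.norm_real, Real.norm_eq_abs,
    abs_of_nonneg (inv_nonneg.2 (norm_nonneg _)),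
    inv_mul_cancel₀ (norm_ne_zero_iff.2 (ccPsi_ne_zero hab α m))]

/-- **`⟨ξ_0|ζ⟩ = (Σ_{|k|≤m} h(k)²)^{−1/2} = 1/‖h‖₂`, exactly** (from `⟨ξ_0|ψ⟩ = L^{−1/2}` and
`‖ψ‖ = L^{−1/2}‖h‖₂`): the quantity of Fact 6.5.  (Consistency of the printed numbers: (normpsi)
`‖h‖₂ ∼ 1.05143` gives `1/‖h‖₂ ≈ 0.95109`, in line with the first-method component `c_0 ∼ 0.951067`
(p. 26), while Fact 6.5 prints `⟨ξ_0|ζ⟩ ∼ 0.94865`; the proof of Lemma 6.10 uses the smaller value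
`0.94865`, the conservative direction — see `CC2021_fact_6_5`.) PROVED.
[cite: ConnesConsani2021, Fact 6.5 §6.5 p. 25; display (normpsi) p. 25] -/
theorem inner_expVector_zero_ccZeta (hab : a < b) (α : ℕ → ℝ) (m : ℕ) :
    ⟪expVector a b 0, ccZeta a b α m⟫_ℂ
      = (((Real.sqrt (∑ k ∈ Finset.Icc (-(m : ℤ)) m, hProd α m k ^ 2))⁻¹ : ℝ) : ℂ) := by
  have hba : 0 < b - a := sub_pos.2 hab
  have hn : ‖ccPsi a b α m‖
      = Real.sqrt (b - a)⁻¹ * Real.sqrt (∑ k ∈ Finset.Icc (-(m : ℤ)) m, hProd α m k ^ 2) := by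
    rw [← Real.sqrt_mul (inv_nonneg.2 hba.le), ← norm_ccPsi_sq hab, Real.sqrt_sq (norm_nonneg _)]
  rw [ccZeta, inner_smul_right, inner_expVector_zero_ccPsi hab, ← Complex.ofReal_mul, hn,
    Real.sqrt_inv, mul_inv, inv_inv, mul_assoc, mul_comm ((Real.sqrt _)⁻¹) _, ← mul_assoc,
    mul_inv_cancel₀ (Real.sqrt_pos.2 hba).ne', one_mul]

/-- `ξ_0 = η_0`: CC's `ξ_0` of (xialpha) (`expVector a b 0`) is "the constant function normalized to
be of norm `1`" (`constVector a b` of `JumpFormula`). PROVED.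
[cite: ConnesConsani2021, §6.7 p. 28; Fact 6.5 p. 25] -/
theorem expVector_zero_eq_constVector (a b : ℝ) : expVector a b 0 = constVector a b := by
  refine Lp.ext ?_
  filter_upwards [coeFn_expVector a b 0, coeFn_constVector a b] with x hx hx'
  rw [hx, hx']
  simp [expFun]

/-! ## Lemma 6.4: `ψ ⊥ ξ_{±α_n}` and `Tψ = λψ` -/

/-- RH-FREE (exact). **Connes–Consani 2021, Lemma 6.4 — the orthogonality (psiortho), second part**
(= arXiv Lemma 37, §6.5 p. 25): "`⟨ξ_{α_n}|ψ⟩ = 0, ∀ n ≠ 0`" (with `α_{−n} = −α_n`), on the window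
`[a, b]` and for the angles `1 ≤ n ≤ m` (for `|n| > m`, `α_n = n` and the statement is
`inner_expVector_intCast_ccPsi_of_lt`, PROVED).  Printed proof: Fourier inversion gives
`⟨ξ_{α_n}|ψ⟩ = L^{−1/2} h(α_n) = 0`.  With `ψ` in its expansion on `(ξ_k)` and CC's SYMMETRIC window
(`a + b = 0`, where `⟨ξ_β|ξ_k⟩ = sinc(π(k − β))`) this is the sampling identity
`Σ_{|k|≤m} h(k) sinc(π(α − k)) = h(α)` (a partial-fraction identity of the rational function
`h(z)·πz/sin(πz)`), dischargeable; typed as a predicate on the data `(a, b, α, m)`.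
[cite: ConnesConsani2021, Lemma 6.4 §6.5 p. 25, display (psiortho)] -/
def CC2021_lemma_6_4_orthogonality (a b : ℝ) (α : ℕ → ℝ) (m : ℕ) : Prop :=
  ∀ n : ℕ, 1 ≤ n → n ≤ m →
    ⟪expVector a b (α n), ccPsi a b α m⟫_ℂ = 0 ∧ ⟪expVector a b (-(α n)), ccPsi a b α m⟫_ℂ = 0

/-- RH-FREE (exact; line 1). **Connes–Consani 2021, Lemma 6.4** (= arXiv Lemma 37, §6.5 p. 25) as a
closed NAMED FACT: on every symmetric window `[a, b]`, `a + b = 0` (CC: `[−½log 2, ½log 2]`), for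
every `m` and all non-zero angles `α_1, …, α_m`, the vector `ψ = L^{−1/2}Σ_{|k|≤m} h(k) ξ_k` is
orthogonal to `ξ_{±α_n}`, `1 ≤ n ≤ m` — whence (PROVED below, `opT_ccPsi`) "`Tψ = λψ`" for the
operator `T` of (opT), and `⟨ξ_0|ψ⟩ = L^{−1/2}` (`inner_expVector_zero_ccPsi`, PROVED).  As printed:
"The Fourier transform `ψ(x) = (1/log 2) ĥ(x/log 2)` of `h(z log 2)` has support in the interval
`I = [−½log 2, ½log 2]`.  One has `Tψ = λψ` and (using the conventions of Lemma 6.3)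
`⟨ξ_0|ψ⟩ = (log 2)^{−1/2}`, `⟨ξ_{α_n}|ψ⟩ = 0, ∀ n ≠ 0`."  Not discharged in this file (discharge =
Shannon sampling for the finitely-sampled `h`, i.e. partial fractions; cell DAG node).
[cite: ConnesConsani2021, Lemma 6.4 §6.5 p. 25] -/
def CC2021_lemma_6_4 : Prop :=
  ∀ (a b : ℝ) (α : ℕ → ℝ) (m : ℕ), a < b → a + b = 0 → (∀ n : ℕ, 1 ≤ n → n ≤ m → α n ≠ 0) →
    CC2021_lemma_6_4_orthogonality a b α m

/-- `(e_0 + Σ_{n=1}^{m}(e_n + e_{−n}))ψ = ψ`: `ψ` lies in the span of the `ξ_k`, `|k| ≤ m` ("all the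
terms … for `|n| > m` vanish", Lemma 6.3, via `expProj_partial_sum_eq_self`). PROVED.
[cite: ConnesConsani2021, Lemma 6.4 §6.5 p. 25 (proof)] -/
theorem expProj_partial_sum_ccPsi (hab : a < b) (α : ℕ → ℝ) (m : ℕ) :
    expProj a b 0 (ccPsi a b α m) + ∑ n ∈ Finset.Icc 1 m,
      (expProj a b n (ccPsi a b α m) + expProj a b (-(n : ℝ)) (ccPsi a b α m))
        = ccPsi a b α m := by
  refine expProj_partial_sum_eq_self hab m (fun n hn ↦ ?_) (fun n hn ↦ ?_)
  · have h := inner_expVector_intCast_ccPsi_of_lt hab α (k := (n : ℤ))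
      (by rw [Nat.abs_cast]; exact_mod_cast hn)
    rwa [Int.cast_natCast] at h
  · have h := inner_expVector_intCast_ccPsi_of_lt hab α (k := -(n : ℤ))
      (by rw [abs_neg, Nat.abs_cast]; exact_mod_cast hn)
    rwa [Int.cast_neg, Int.cast_natCast] at h

/-- **"One has `Tψ = λψ`"** (Lemma 6.4) DERIVED from the orthogonality `ψ ⊥ ξ_{±α_n}` ("The
orthogonality of `ψ` to all the vectors `ξ_{α_n}` shows using (opT) that `Tψ = λΣe_nψ = λψ`", p. 25),
for the tree's `T = opT` with any `λ` and coefficients `d`. PROVED (modulo the orthogonality predicate).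
[cite: ConnesConsani2021, Lemma 6.4 §6.5 p. 25] -/
theorem opT_ccPsi (hab : a < b) {α : ℕ → ℝ} {m : ℕ} (h : CC2021_lemma_6_4_orthogonality a b α m)
    (lam : ℝ) (d : ℕ → ℝ) :
    opT a b lam α d m (ccPsi a b α m) = (lam : ℂ) • ccPsi a b α m :=
  opT_apply_of_orthogonal lam α d m
    (fun n hn ↦ (h n (Finset.mem_Icc.1 hn).1 (Finset.mem_Icc.1 hn).2).1)
    (fun n hn ↦ (h n (Finset.mem_Icc.1 hn).1 (Finset.mem_Icc.1 hn).2).2)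
    (expProj_partial_sum_ccPsi hab α m)

/-- `Tζ = λζ` for the unit vector `ζ = ψ/‖ψ‖` — the top eigenpair `(η, λ_max)` of §6.7 p. 28 in the
shape of the binder `heig` of
`MainInequalityAssembly.weilArchPositivity_soninTrace_fine_of_spectralData`. PROVED (modulo the
orthogonality predicate). [cite: ConnesConsani2021, Lemma 6.4 §6.5 p. 25; §6.7 p. 28] -/
theorem opT_ccZeta (hab : a < b) {α : ℕ → ℝ} {m : ℕ} (h : CC2021_lemma_6_4_orthogonality a b α m)
    (lam : ℝ) (d : ℕ → ℝ) :
    opT a b lam α d m (ccZeta a b α m) = ((lam : ℝ) : ℂ) • ccZeta a b α m := by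
  rw [ccZeta, map_smul, opT_ccPsi hab h lam d, smul_comm]

/-! ## Lemma 6.6 (the `(log Γ)''` closed form of the Parseval tails) and the quantities of Lemma 6.8 (ii) -/

/-- RH-FREE. The trigamma series `(log Γ)^{(2)}(x) = Σ_{k≥0} (x + k)^{−2}` (`x > 0`) —
"`(log Γ)^{(2)}` the derivative of the logarithmic derivative of the `Γ`-function"; the proof of
Lemma 6.6 uses exactly this series ("`Σ_{k=0}^{∞}(n−a+k)^{−2} = (log Γ)^{(2)}(n−a)`", p. 25).  Typed
as the series (Mathlib has no polygamma function); junk value `0` where the series diverges.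
[folklore] -/
def trigammaSum (x : ℝ) : ℝ := ∑' k : ℕ, 1 / (x + k) ^ 2

/-- RH-FREE (exact; line 1). **Connes–Consani 2021, Lemma 6.6** (= arXiv Lemma 39, §6.6 p. 25):
"Let `(log Γ)^{(2)}` be the derivative of the logarithmic derivative of the `Γ`-function, then one has
(majorred) `‖ξ_α − P(n)ξ_α‖² = π^{−2} sin²(πα)((log Γ)^{(2)}(n−α) + (log Γ)^{(2)}(α+n))`,
`∀ α ∈ [−n, n]`", `P(n)` "the orthogonal projection on the linear span of the vectors `ξ_j`, for
`|j| < n`" (`Σ_{|j|<n} e_j`).  Typed on a symmetric window `[a, b]`, `a + b = 0` (CC: `L = log 2`;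
there `⟨ξ_k|ξ_α⟩ = sinc(π(α − k))`, "`(ξ_α)_k = sin(π(α−k))/(π(α−k))`"), with the trigamma SERIES
and for `α` in the OPEN interval `(−n, n)`: at `α = ±n` the printed right-hand side is `0·∞` (its
limit is `1`, the value of the left side), a boundary convention Lean cannot render.  The Parseval
step `‖ξ_α − P(n)ξ_α‖² = Σ_{|k|≥n} sinc(π(α−k))²` is `hasSum_sinc_sq_norm_sub_proj`
(`ExponentialBasis`, PROVED); the remaining step is the re-indexing of the two tails. Not discharged in
this file (cell DAG node, dischargeable). [cite: ConnesConsani2021, Lemma 6.6 §6.6 p. 25, display (majorred)] -/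
def CC2021_lemma_6_6 : Prop :=
  ∀ (a b : ℝ) (n : ℕ) (α : ℝ), a < b → a + b = 0 → α ∈ Ioo (-(n : ℝ)) n →
    ‖expVector a b α - ∑ j ∈ Finset.Ioo (-(n : ℤ)) n, expProj a b j (expVector a b α)‖ ^ 2
      = π⁻¹ ^ 2 * Real.sin (π * α) ^ 2 * (trigammaSum (n - α) + trigammaSum (α + n))

/-- RH-FREE. **The quantity `ε(j,N)` of Lemma 6.8 (ii)** (p. 26): "`ε(j,N) := π^{−2} sin²(πα_j)
((log Γ)^{(2)}(N−α_j) + (log Γ)^{(2)}(α_j+N))`" (`= ‖ζ_j − P(N)ζ_j‖²` by (majorred), for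
`0 < |j| ≤ N`, `N > m`; it vanishes for `m < j` since then `α_j = j ∈ ℤ`).
[cite: ConnesConsani2021, Lemma 6.8 (ii) §6.6 p. 26] -/
def ccEpsJN (α : ℕ → ℝ) (m j N : ℕ) : ℝ :=
  π⁻¹ ^ 2 * Real.sin (π * ccAngle α m j) ^ 2 *
    (trigammaSum (N - ccAngle α m j) + trigammaSum (ccAngle α m j + N))

/-- RH-FREE. **The quantity `e(N)` of Lemma 6.8 (ii)** (p. 26): "`e(N)² = Σ_{|j|≤N} ε(j,N)`"; the
`j = 0` term is absent ("Since we assume `N > m`, one has `ζ_0 = P(N)ζ_0`") and `ε(−j,N) = ε(j,N)`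
(`α_{−j} = −α_j`), so `e(N)² = 2Σ_{j=1}^{N} ε(j,N)`.  Printed value for `N = 2000`: `e(N) ∼ 0.0145`.
[cite: ConnesConsani2021, Lemma 6.8 (ii) §6.6 pp. 26–27, display (aminusan)] -/
def ccEN (α : ℕ → ℝ) (m N : ℕ) : ℝ := Real.sqrt (2 * ∑ j ∈ Finset.Icc 1 N, ccEpsJN α m j N)

/-- RH-FREE. **The quantity `e′(N)` of Lemma 6.8 (ii)** (p. 26): "`e′(N)² = Σ_{|j|≤N} d(|j|)² ε(j,N)`"
(same conventions; `d(j) = 1` for `j > m`).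
[cite: ConnesConsani2021, Lemma 6.8 (ii) §6.6 pp. 26–27, display (aminusan)] -/
def ccEprimeN (α d : ℕ → ℝ) (m N : ℕ) : ℝ :=
  Real.sqrt (2 * ∑ j ∈ Finset.Icc 1 N, (if j ≤ m then d j else 1) ^ 2 * ccEpsJN α m j N)

/-- RH-FREE. **`ε(N) = max(e(N), e′(N))`** (Lemma 6.8 (ii) p. 26; printed: `∼ 0.017` for `N = 2000`,
`∼ 0.00740487` for `N = 10 000`). [cite: ConnesConsani2021, Lemma 6.8 (ii) §6.6 p. 26] -/
def ccEpsN (α d : ℕ → ℝ) (m N : ℕ) : ℝ := max (ccEN α m N) (ccEprimeN α d m N)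

/-- RH-FREE. **The perturbation bound `ε₁(N)` of the proof of Lemma 6.8 (ii)** (display (apriori1),
p. 27): "`‖Π − Π_N‖ ≤ ½(s/r)^{3/2} e(N) + (s/r)^{1/2} max(e(N), e′(N)) + ½(s/r) e(N) := ε₁(N)`", with
`0 < r < 1 < s`, `Spec J ⊂ [r, s]`, `‖A‖ ≤ s` (printed for `N = 2000`: `s = 1.578`, `r = 0.299`,
`s/r ∼ 5.27`, whence `ε₁(N) ≤ 11 ε(N)`).
[cite: ConnesConsani2021, Lemma 6.8 (ii) §6.6 p. 27, display (apriori1)] -/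
def ccEps1N (α d : ℕ → ℝ) (m N : ℕ) (r s : ℝ) : ℝ :=
  1 / 2 * (s / r) ^ (3 / 2 : ℝ) * ccEN α m N + (s / r) ^ (1 / 2 : ℝ) * ccEpsN α d m N
    + 1 / 2 * (s / r) * ccEN α m N

/-- The printed arithmetic behind "`ε₁(N) ≤ 11 ε(N)`" (p. 27): with `s/r ≤ 5.27` and `e(N) ≤ ε(N)`,
`½(s/r)^{3/2} + (s/r)^{1/2} + ½(s/r) ≤ ½·5.27·√5.27 + √5.27 + 2.635 < 11` — certified through
`√5.27 < 2.2957`: `10.98 < 11`.  PROVED (arithmetic only; `r, s` are floating-point outputs for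
`N = 2000`). [cite: ConnesConsani2021, Lemma 6.8 (ii) §6.6 p. 27] -/
theorem printedConstants_eps1N :
    1 / 2 * (5.27 : ℝ) * Real.sqrt 5.27 + Real.sqrt 5.27 + 1 / 2 * 5.27 < 11 := by
  have hs : Real.sqrt 5.27 < 2.2957 := by
    rw [Real.sqrt_lt' (by norm_num)]
    norm_num
  nlinarith [Real.sqrt_nonneg 5.27]

/-! ## The printed numerical inputs (N2)–(N4) AS PRINTED

Every `def … : Prop` of this section is NUMERICAL-IN-PRINT: a floating-point output of the source
("up to some computational imprecision which we evaluate later", §6.7 p. 28; no interval arithmetic is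
claimed in print), typed in the operative one-sided form in which the proof of Lemma 6.10 /
Theorem 6.11 consumes it, never asserted as a theorem and never re-computed here.  The supplementary
DATA (`α_n`, `d(n)`, `n ≤ 1732`, not printed) and the density `G` of the functional `E₊` (in print
`G = ε∘exp` on `[0, ∞)`, §5 — typed with `G` as a parameter exactly as in `MainInequalityAssembly`) are
parameters, and so is the window `[a, b]` (CC: `[−½log 2, ½log 2]`). -/

/-- NUMERICAL-IN-PRINT (line 1). **Connes–Consani 2021, Fact 6.1** (= arXiv Fact 34, §6.3 p. 24).
As printed: "The distance in `L¹([0, log 2], dx)` of the function `χ(x) := (Qε)(exp|x|)/(2ε′(1₊))` to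
the function `τ(λ,α,d,m)(x)` of (approx0) (for `m = 1732`, and with the values of the angles `α_j` and
of the coefficients `d(j)` fixed above) fulfills (computerverif)
`2∫₀^{log 2} |τ(λ,α,d,m)(x) − χ(x)| dx ∼ 0.00122`. *Proof.* The proof is a computer calculation of the
`L¹([0, log 2], dx)` norm of the difference of the two functions."  Typed on the window `[a, b]`
(`b − a = log 2` in print): `τ = tauKernel a b` (the display (approx0) verbatim, `FiniteRankApproximant`)
at the printed `λ = λ_max = 1.05158` ((opTeigen) p. 26) and `m = 1732`, `χ = varpi G` (`JumpFormula`: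
`ϖ_G(v) = (opQ G)(|v|)/(2G′(0))`, CC: `G = ε∘exp`), and the printed `∼ 0.00122` in the one-sided form
`≤ 0.00122` in which §6.7 uses it ("(spectral0) `‖𝐊_I − T‖ ≤ ε₁`, `ε₁ ≃ 0.00122`", p. 28).  The
angles and coefficients are the source's supplementary tables (p. 23–24, "can be downloaded"), here
the parameters `α d`.  WHAT THIS IS NOT: a certified enclosure; a statement about RH.
  STATUS (cell bookkeeping, cc/ASSIGNMENTS R7, 2026-08-26):
SUPERSEDED-BY-ENCLOSURE — on the K3 path (`WindowSpectralBound`) this printed input is replaced by the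
kernel-checked Route A-F certificate `SpectralCertCheck.lean` (data `SpectralCert.CertAF`: frame kernel at
half-integer frequencies, `N = 100`, `ε₁ = 1/400`, `a₀ = 127/2000`; `SpectralCert.windowSpectralBound_of_L1`)
and its ONE external input `CC2021_section6_enclosures` (`SpectralCertificate.lean`); kept here AS PRINTED
for the record, never discharged.
[cite: ConnesConsani2021, Fact 6.1 §6.3 p. 24, display (computerverif); §6.7 p. 28 display (spectral0)] -/
def CC2021_fact_6_1 (a b : ℝ) (G : ℝ → ℂ) (α d : ℕ → ℝ) : Prop :=
  2 * ∫ x in Icc 0 (b - a), ‖tauKernel a b 1.05158 α d 1732 x - varpi G x‖ ≤ 0.00122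

/-- NUMERICAL-IN-PRINT (line 1). **Connes–Consani 2021, Fact 6.5** (= arXiv Fact 38, §6.5 p. 25).
As printed: "The important numerical fact is — Fact 6.5. For `m = 1732`, one has:
`⟨ξ_0|ζ⟩ ∼ 0.94865`, where `ζ(x) = ψ(x)/‖ψ‖₂`."  Typed on the window `[a, b]` in the one-sided form
`0.94865 ≤ |⟨ξ_0|ζ⟩|` in which the proof of Lemma 6.10 consumes it (p. 28: the second positivity
condition `a((c+b)|⟨ζ|ξ_0⟩|² − b) ≥ bc` and the gap `ε₂` of Lemma 6.9 are monotone in `|⟨ζ|ξ_0⟩|`,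
`rankOneGap_mono`), with `ζ = ccZeta a b α 1732`.  CONSISTENCY NOTE (source-internal): by Lemma 6.4
and (normpsi), `⟨ξ_0|ζ⟩ = 1/‖h‖₂` exactly (`inner_expVector_zero_ccZeta`, PROVED), and the printed
`‖h‖₂ ∼ 1.05143` gives `0.95109`, in line with the first-method component `c_0 ∼ 0.951067` (p. 26);
the printed `0.94865` is `0.26 %` smaller, the conservative direction for Lemma 6.10, so the one-sided
typing is implied by either printed value.  WHAT THIS IS NOT: a certified enclosure; a statement
about RH.
  STATUS (cell bookkeeping, cc/ASSIGNMENTS R7, 2026-08-26):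
SUPERSEDED-BY-ENCLOSURE — on the K3 path (`WindowSpectralBound`) this printed input is replaced by the
kernel-checked Route A-F certificate `SpectralCertCheck.lean` (data `SpectralCert.CertAF`: frame kernel at
half-integer frequencies, `N = 100`, `ε₁ = 1/400`, `a₀ = 127/2000`; `SpectralCert.windowSpectralBound_of_L1`)
and its ONE external input `CC2021_section6_enclosures` (`SpectralCertificate.lean`); kept here AS PRINTED
for the record, never discharged.
[cite: ConnesConsani2021, Fact 6.5 §6.5 p. 25] -/
def CC2021_fact_6_5 (a b : ℝ) (α : ℕ → ℝ) : Prop :=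
  (0.94865 : ℝ) ≤ ‖⟪expVector a b 0, ccZeta a b α 1732⟫_ℂ‖

/-- NUMERICAL-IN-PRINT (line 1). **Connes–Consani 2021, Lemma 6.8 (iii)** (= arXiv Lemma 41 (iii),
§6.6 p. 26) in the operative form of the spectral decomposition (spectral) of §6.7 p. 28.  As printed:
"(iii) The spectrum of `T` is contained in `{λ_max} ∪ [−2, λ₂]`, where `λ₂ ≤ 0.772216`" (proof:
"(iii) We use (ii) and take `N = 10 000`.  One gets `ε(N) ∼ 0.00740487`, while the first non-zero
eigenvalue of the matrix `A^{(N)}` is `β₂^{(N)} = 0.347112`.  Thus by (ii) … `β₂ ≥ β₂^{(N)} − 11ε(N)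
∼ 0.265658`.  This shows that the second eigenvalue `λ₂ = λ_max(1 − β₂)` of `T` fulfills
`λ₂ ≤ 0.772216`"), used on p. 28 as "`T = λ_max|η⟩⟨η| + R`, `R ≤ λ₂P_η`" with `η = ζ` the
eigenvector of Lemma 6.4 / Fact 6.5.  Typed on the window `[a, b]`, for the self-adjoint finite-rank
`T = opT a b 1.05158 α d 1732` (`isSelfAdjoint_opT`): on `ζ^⊥` the quadratic form of `T` lies in
`[−2, λ₂]·‖·‖²` with `λ₂ = 0.772216` — the upper half is literally the binder `hTl₂` of
`MainInequalityAssembly.weilArchPositivity_soninTrace_fine_of_spectralData`.  Parts (i)–(ii) of the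
lemma (the similarity `Spec T = {λ_max(1 − β_j)}`, `β_j` the eigenvalues of the infinite matrix
`A_{n,k} = d(|k|)⟨ζ_n|ζ_k⟩` on `ℓ²(ℤ)`, and the perturbation bound `11ε(N)`) organise this
computation; their explicit quantities are `ccEpsJN`, `ccEN`, `ccEprimeN`, `ccEpsN`, `ccEps1N`,
their statements are not typed (bounded operators on `ℓ²(ℤ)` from infinite matrices).  WHAT THIS IS
NOT: a certified enclosure; a statement about RH.
  STATUS (cell bookkeeping, cc/ASSIGNMENTS R7, 2026-08-26):
SUPERSEDED-BY-ENCLOSURE — on the K3 path (`WindowSpectralBound`) this printed input is replaced by the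
kernel-checked Route A-F certificate `SpectralCertCheck.lean` (data `SpectralCert.CertAF`: frame kernel at
half-integer frequencies, `N = 100`, `ε₁ = 1/400`, `a₀ = 127/2000`; `SpectralCert.windowSpectralBound_of_L1`)
and its ONE external input `CC2021_section6_enclosures` (`SpectralCertificate.lean`); kept here AS PRINTED
for the record, never discharged.
[cite: ConnesConsani2021, Lemma 6.8 (iii) §6.6 pp. 26–27; §6.7 p. 28 display (spectral)] -/
def CC2021_lemma_6_8_iii (a b : ℝ) (α d : ℕ → ℝ) : Prop :=
  ∀ ζ : Lp ℂ 2 (volume.restrict (Icc a b)), ⟪ccZeta a b α 1732, ζ⟫_ℂ = 0 →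
    -2 * ‖ζ‖ ^ 2 ≤ RCLike.re ⟪ζ, opT a b 1.05158 α d 1732 ζ⟫_ℂ ∧
      RCLike.re ⟪ζ, opT a b 1.05158 α d 1732 ζ⟫_ℂ ≤ 0.772216 * ‖ζ‖ ^ 2

/-- NUMERICAL-IN-PRINT (line 1) — it rests on `λ_max = 1.05158`, `ε₁ ≃ 0.00122` ((spectral0),
[Simon] Thm. 1.7: `|λ₁(𝐊_I) − λ_max| ≤ ε₁`), `ε′(1₊) ≃ 22.9965` (`0.1·ε′(1₊)·4/log 2 ≈ 13.27 > 13`)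
and Theorem 4.7. **Connes–Consani 2021, Remark 6.12** (= arXiv Remark 45, §6.7 p. 29).  As printed:
"… there exists a unit vector `ξ ∈ C_c^∞((−½log 2, ½log 2))` such that `𝐊_I(ξ) ∼ λ₁(𝐊_I)ξ` …
`E(g∗g*) = E∘Q(h∗h*) = ⟨ξ|N_I(ξ)⟩ ≥ 0.1ε′(1₊)|⟨ξ_0|ξ⟩|² > 13|ĝ(0)|²`.  Thus by (sonine1thm) one gets
`W_∞(g∗g*) = Tr(ϑ(g)𝐒ϑ(g)*) − E(g∗g*) < Tr(ϑ(g)𝐒ϑ(g)*) − 13|ĝ(0)|²`.  This shows that the best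
constant `c` fulfilling (maininequ) is such that `13 < c < 17`."  Typed as the companion of the tree's
`WeilArchPositivity_soninTrace_fine` (`∃ c < 17`, = Thm. 6.11) in the same weak-trace typing
(`ArchimedeanSoninTrace`, "How the trace is typed": `Tr(ϑ(g)𝐒ϑ(g)*)` exceeds a bound iff some finite
orthonormal family in `S(1,1)` does): the inequality (maininequ) with `c = 13` FAILS for some
admissible `g` (vanishing at `−i/2`, the convention of Thm. 6.11 / Rem. 6.12).  The upper half
`c < 17` is `WeilArchPositivity_soninTrace_fine` itself.  WHAT THIS IS NOT: a certified computation;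
a statement about RH. [cite: ConnesConsani2021, Remark 6.12 §6.7 p. 29] -/
def CC2021_rem_6_12 : Prop :=
  ∃ g : ℝ → ℂ, IsWeilTest g ∧ tsupport g ⊆ Icc (-(Real.log 2 / 2)) (Real.log 2 / 2) ∧
    mulFourier g (-(I / 2)) = 0 ∧
    ∃ (n : ℕ) (ξ : Fin n → Lp ℂ 2 (volume : Measure ℝ)),
      Orthonormal ℂ ξ ∧ (∀ i, ξ i ∈ soninSpace 1 1) ∧
        (archW (weilConv g (weilReflect g))).re
          < ∑ i, (soninTraceForm (weilConv g (weilReflect g)) (ξ i : ℝ → ℂ)).re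
              - 13 * ‖mulFourier g 0‖ ^ 2

/-! ## Remark 6.7: the parity symmetry of `T` -/

/-- **Connes–Consani 2021, Remark 6.7** (= arXiv Remark 40, §6.6 p. 26), the operator-theoretic
content: "the finite dimensional real symmetric matrix `M = P(m)TP(m)` fulfills the further symmetry
`M_{−i,−j} = M_{i,j}`, i.e. it commutes with the parity involution" — for the matrix coefficients of
`T = opT` itself on CC's symmetric window: `⟨ξ_{−i}|Tξ_{−j}⟩ = ⟨ξ_i|Tξ_j⟩` for all integers `i, j`
(`τ` is even: the sum (opT) pairs `e_β` with `e_{−β}`, and `⟨ξ_i|ξ_β⟩ = sinc(π(β − i))`).  The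
remaining sentences ("It follows that the eigenvectors associated to simple eigenvalues are even or
odd … One finds, for example, that the eigenvector associated to the second eigenvalue `λ₂` is odd")
are `involution_apply_eq_or_eq_neg_of_simple` below and a numerical observation (not typed). PROVED.
[cite: ConnesConsani2021, Remark 6.7 §6.6 p. 26] -/
theorem inner_expVector_neg_opT_expVector_neg {L : ℝ} (hL : 0 < L) (lam : ℝ) (α d : ℕ → ℝ)
    (m : ℕ) (i j : ℤ) :
    ⟪expVector (-(L / 2)) (L / 2) (-(i : ℝ)), opT (-(L / 2)) (L / 2) lam α d m
        (expVector (-(L / 2)) (L / 2) (-(j : ℝ)))⟫_ℂ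
      = ⟪expVector (-(L / 2)) (L / 2) i, opT (-(L / 2)) (L / 2) lam α d m
          (expVector (-(L / 2)) (L / 2) j)⟫_ℂ := by
  have hG : ∀ β γ δ : ℝ, ⟪expVector (-(L / 2)) (L / 2) (-γ), expProj (-(L / 2)) (L / 2) (-β)
      (expVector (-(L / 2)) (L / 2) (-δ))⟫_ℂ
        = ⟪expVector (-(L / 2)) (L / 2) γ, expProj (-(L / 2)) (L / 2) β
            (expVector (-(L / 2)) (L / 2) δ)⟫_ℂ := by
    intro β γ δ
    rw [inner_expProj, inner_expProj, inner_expVector_expVector_symm hL,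
      inner_expVector_expVector_symm hL, inner_expVector_expVector_symm hL,
      inner_expVector_expVector_symm hL, show -β - -γ = -(β - γ) by ring,
      show -δ - -β = -(δ - β) by ring, mul_neg, mul_neg, Real.sinc_neg, Real.sinc_neg]
  have h0 := hG 0 i j
  rw [neg_zero] at h0
  simp only [opT, FunLike.coe_smul, Pi.smul_apply, FunLike.coe_add, Pi.add_apply, FunLike.coe_sub,
    Pi.sub_apply, FunLike.coe_sum, Finset.sum_apply, inner_smul_right, inner_add_right,
    inner_sub_right, inner_sum, h0]
  congr 2
  refine Finset.sum_congr rfl fun n _ ↦ ?_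
  have h1 := hG n i j
  have h2 := hG (-(n : ℝ)) i j
  have h3 := hG (α n) i j
  have h4 := hG (-(α n)) i j
  rw [neg_neg] at h2 h4
  rw [h2, h1, h4, h3,
    add_comm ⟪expVector (-(L / 2)) (L / 2) (i : ℝ), expProj (-(L / 2)) (L / 2) (-(n : ℝ)) _⟫_ℂ,
    add_comm ⟪expVector (-(L / 2)) (L / 2) (i : ℝ), expProj (-(L / 2)) (L / 2) (-(α n)) _⟫_ℂ]

/-- **Remark 6.7, the linear-algebra step** ("It follows that the eigenvectors associated to simple
eigenvalues are even or odd (with respect to the parity involution)"): if an involution `S` commutes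
with `M` and `v` spans the `μ`-eigenspace of `M`, then `Sv = v` or `Sv = −v` (elementary linear
algebra, stated for any involution on a complex vector space). PROVED.
[cite: ConnesConsani2021, Remark 6.7 §6.6 p. 26] -/
theorem involution_apply_eq_or_eq_neg_of_simple {V : Type*} [AddCommGroup V] [Module ℂ V]
    {S M : V →ₗ[ℂ] V} (hS : ∀ v, S (S v) = v) (hSM : ∀ v, S (M v) = M (S v)) {μ : ℂ} {v : V}
    (hv : M v = μ • v) (hsimple : ∀ w, M w = μ • w → ∃ c : ℂ, w = c • v) :
    S v = v ∨ S v = -v := by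
  have hSv : M (S v) = μ • S v := by rw [← hSM, hv, map_smul]
  obtain ⟨c, hc⟩ := hsimple (S v) hSv
  by_cases hv0 : v = 0
  · left
    rw [hv0, map_zero]
  have hc2 : (c * c) • v = v := by
    have h2 : S (S v) = (c * c) • v := by rw [hc, map_smul, hc, smul_smul]
    rw [← h2, hS]
  have hcc : c * c = 1 := by
    by_contra hne
    apply hv0
    have h2 : (c * c - 1) • v = 0 := by rw [sub_smul, one_smul, hc2, sub_self]
    rcases smul_eq_zero.1 h2 with h | h
    · exact absurd (sub_eq_zero.1 h) hne
    · exact h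
  have hc1 : c = 1 ∨ c = -1 := by
    have h3 : (c - 1) * (c + 1) = 0 := by
      have e : (c - 1) * (c + 1) = c * c - 1 := by ring
      rw [e, hcc, sub_self]
    rcases mul_eq_zero.1 h3 with h | h
    · exact Or.inl (sub_eq_zero.1 h)
    · exact Or.inr (eq_neg_of_add_eq_zero_left h)
  rcases hc1 with h | h
  · left
    rw [hc, h, one_smul]
  · right
    rw [hc, h, neg_one_smul]

/-! ## The hand-over: the §6 inputs feed the binders of `MainInequalityAssembly` (PROVED links) -/

/-- `−½log 2 < ½log 2`. [folklore] -/
private theorem neg_half_log_two_lt' : -(Real.log 2 / 2) < Real.log 2 / 2 := by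
  have := Real.log_pos (one_lt_two : (1 : ℝ) < 2)
  linarith

/-- **`hsa`**: "both `T` and `𝐊_I` are self-adjoint" (§6.7 p. 28) — the symmetry of `T = opT` in the
binder form `⟪T x, y⟫ = ⟪x, T y⟫` (`isSelfAdjoint_opT`). PROVED. [cite: ConnesConsani2021, §6.7 p. 28] -/
theorem inner_opT_comm (hab : a < b) (lam : ℝ) (α d : ℕ → ℝ) (m : ℕ)
    (x y : Lp ℂ 2 (volume.restrict (Icc a b))) :
    ⟪opT a b lam α d m x, y⟫_ℂ = ⟪x, opT a b lam α d m y⟫_ℂ := by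
  simpa using (isSelfAdjoint_opT hab lam α d m).isSymmetric x y

/-- **`hKT` from Fact 6.1 through Lemma 6.3**: "(spectral0) `‖𝐊_I − T‖ ≤ ε₁`" with `ε₁ = 0.00122`
(§6.7 p. 28: "The above computation … together with Lemma 6.3 and the estimate (computerverif)
provide the needed information"), for `𝐊_I = windowOp ϖ_G` and CC's `T`: both kernels are even, so
the `L¹` distance over `[a − b, b − a]` is the printed `2∫₀^{b−a}` (`opNorm_sub_le_of_windowForm_even`).
PROVED (modulo Fact 6.1).
[cite: ConnesConsani2021, §6.7 p. 28 display (spectral0); Lemma 6.3 §6.4 p. 24; Fact 6.1 p. 24] -/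
theorem norm_windowOp_sub_opT_le_of_fact_6_1 (hab : a < b) {G : ℝ → ℂ} (hG : ContDiff ℝ 2 G)
    {α d : ℕ → ℝ} (h : CC2021_fact_6_1 a b G α d) :
    ‖windowOp a b (integrableOn_varpi hG a b) - opT a b 1.05158 α d 1732‖ ≤ 0.00122 :=
  opNorm_sub_le_of_windowForm_even hab.le (integrableOn_varpi hG a b)
    (integrableOn_tauKernel a b 1.05158 α d 1732) (inner_windowOp _) (inner_opT hab 1.05158 α d 1732)
    (fun v ↦ by rw [tauKernel_neg, varpi_neg]) h

/-- The gap `ε` of Lemma 6.9 is monotone in the overlap `t = |⟨φ|ψ⟩|` (for `a ≥ 0`, `b + c ≥ 0`,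
`t ≥ 0`): the reason a LOWER bound on `|⟨ξ_0|ζ⟩|` is what Lemma 6.10 consumes. PROVED.
[cite: ConnesConsani2021, Lemma 6.9 §6.7 p. 28 (display for `2ε`)] -/
theorem rankOneGap_mono {a' b' c t₁ t₂ : ℝ} (ha : 0 ≤ a') (hbc : 0 ≤ b' + c) (ht₁ : 0 ≤ t₁)
    (h : t₁ ≤ t₂) : rankOneGap a' b' c t₁ ≤ rankOneGap a' b' c t₂ := by
  unfold rankOneGap
  have h2 : t₁ ^ 2 ≤ t₂ ^ 2 := pow_le_pow_left₀ ht₁ h 2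
  have hD : (a' + b' + c) ^ 2 - 4 * a' * (b' + c) * t₂ ^ 2
      ≤ (a' + b' + c) ^ 2 - 4 * a' * (b' + c) * t₁ ^ 2 := by
    nlinarith [mul_nonneg ha hbc]
  have := Real.sqrt_le_sqrt hD
  linarith

/-- **`hε` from Fact 6.5 and the printed constants**: `ε₁ = 0.00122 ≤ ε₂ = rankOneGap a (λ_max − 1)
(1 − λ₂) |⟨ζ|η_0⟩|` at `a = 0.064`, `λ_max = 1.05158`, `λ₂ = 0.772216` ("`ε₂ ≃ 0.00441`",
"`ε₁ ≃ 0.00122 < ε₂`", p. 28; arithmetic `printedConstants_posconds` of `RankOnePositivity`,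
monotonicity `rankOneGap_mono`). PROVED (modulo Fact 6.5).
[cite: ConnesConsani2021, Lemma 6.10 §6.7 p. 28 (proof)] -/
theorem eps1_le_rankOneGap_of_fact_6_5 {α : ℕ → ℝ} (h : CC2021_fact_6_5 a b α) :
    (0.00122 : ℝ) ≤ rankOneGap 0.064 (1.05158 - 1) (1 - 0.772216)
      ‖⟪ccZeta a b α 1732, constVector a b⟫_ℂ‖ := by
  have ht : (0.94865 : ℝ) ≤ ‖⟪ccZeta a b α 1732, constVector a b⟫_ℂ‖ := by
    rw [← expVector_zero_eq_constVector, ← inner_conj_symm, RCLike.norm_conj]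
    exact h
  obtain ⟨-, -, hgap, h12⟩ := printedConstants_posconds
  rw [show (1.05158 : ℝ) - 1 = 0.05158 by norm_num,
    show (1 : ℝ) - 0.772216 = 0.227784 by norm_num]
  exact (h12.le.trans hgap).trans (rankOneGap_mono (by norm_num) (by norm_num) (by norm_num) ht)

/-- **`hTl₂`** is the upper half of `CC2021_lemma_6_8_iii`. PROVED (projection).
[cite: ConnesConsani2021, Lemma 6.8 (iii) §6.6 p. 26; §6.7 p. 28 display (spectral)] -/
theorem re_inner_opT_le_of_lemma_6_8_iii {α d : ℕ → ℝ} (h : CC2021_lemma_6_8_iii a b α d)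
    (ζ : Lp ℂ 2 (volume.restrict (Icc a b))) (hζ : ⟪ccZeta a b α 1732, ζ⟫_ℂ = 0) :
    RCLike.re ⟪ζ, opT a b 1.05158 α d 1732 ζ⟫_ℂ ≤ 0.772216 * ‖ζ‖ ^ 2 :=
  (h ζ hζ).2

/-- **The sign-free operator inequality (H-op) of `MainInequalityAssembly` from the §6 inputs as
printed**: `0 ≤ Re⟨ξ|(1 − 𝐊_I)ξ⟩ + a|⟨η_0|ξ⟩|²` with `a = 0.064`, for `𝐊_I = windowOp ϖ_G` on the
window `[a, b]`, given Fact 6.1, Lemma 6.4 (orthogonality), Fact 6.5 and Lemma 6.8 (iii) for the data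
`(α, d)` — the content of the proof of Lemma 6.10 (p. 28) with every floating-point input in its
printed place (`λ_max = 1.05158 ≥ 1`, `λ₂ = 0.772216 ≤ 1`, `a = 0.064 ≥ 0`, `ε₁ = 0.00122 ≤ ε₂`).
PROVED (modulo the four typed inputs). [cite: ConnesConsani2021, Lemma 6.10 §6.7 p. 28 (proof)] -/
theorem opIneq_of_section6 (hab : a < b) {G : ℝ → ℂ} (hG : ContDiff ℝ 2 G) {α d : ℕ → ℝ}
    (h61 : CC2021_fact_6_1 a b G α d) (h64 : CC2021_lemma_6_4_orthogonality a b α 1732)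
    (h65 : CC2021_fact_6_5 a b α) (h68 : CC2021_lemma_6_8_iii a b α d)
    (ξ : Lp ℂ 2 (volume.restrict (Icc a b))) :
    0 ≤ RCLike.re ⟪ξ, ξ - windowOp a b (integrableOn_varpi hG a b) ξ⟫_ℂ
        + 0.064 * ‖⟪constVector a b, ξ⟫_ℂ‖ ^ 2 :=
  opIneq_of_selfAdjoint_eigenvector (norm_ccZeta hab α 1732) (norm_constVector hab)
    (by norm_num : (1 : ℝ) ≤ 1.05158) (by norm_num : (0.772216 : ℝ) ≤ 1)
    (by norm_num : (0 : ℝ) ≤ 0.064) (inner_opT_comm hab 1.05158 α d 1732)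
    (opT_ccZeta hab h64 1.05158 d) (re_inner_opT_le_of_lemma_6_8_iii h68)
    (norm_windowOp_sub_opT_le_of_fact_6_1 hab hG h61) (eps1_le_rankOneGap_of_fact_6_5 h65) ξ

/-- RH-FREE corpus theorem (archimedean place only; line 1). **Eq. (4) / Theorem 6.11 =
`WeilArchPositivity_soninTrace_fine` from the THREE printed inputs, with input (C) = the §6 numerical
certificate AS PRINTED in this file**: (A) Theorem 4.7's weak trace formula on
`I = [−½log 2, ½log 2]` (binder `hTr`, verbatim as in `MainInequalityAssembly`), (B) the density
`G ∈ C²` of `E₊` with `G′(0) = e′ > 0` (§5; CC: `ε′(1₊) ≃ 22.9965`) together with the arithmetic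
`8·0.064·e′/log 2 < 17` (at the printed `e′`: `printedConstants_mainInequality`), (C)
`CC2021_fact_6_1`, `CC2021_lemma_6_4_orthogonality`, `CC2021_fact_6_5`, `CC2021_lemma_6_8_iii` on
CC's window for SOME angles/coefficients `(α, d)` (the source's supplementary tables).  WHAT THIS IS
NOT: a discharge of the fact (inputs (A), (B), (C) remain hypotheses); a statement about RH. PROVED.
[cite: ConnesConsani2021, eq. (4) p. 4; Thm. 6.11 §6.7 pp. 28–29; Lemma 6.10 p. 28] -/
theorem weilArchPositivity_soninTrace_fine_of_section6 {G : ℝ → ℂ} {e' : ℝ} {α d : ℕ → ℝ}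
    (hG : ContDiff ℝ 2 G) (hGe : deriv G 0 = e') (he' : 0 < e')
    (hc : 8 * 0.064 * e' / Real.log 2 < 17)
    (h61 : CC2021_fact_6_1 (-(Real.log 2 / 2)) (Real.log 2 / 2) G α d)
    (h64 : CC2021_lemma_6_4_orthogonality (-(Real.log 2 / 2)) (Real.log 2 / 2) α 1732)
    (h65 : CC2021_fact_6_5 (-(Real.log 2 / 2)) (Real.log 2 / 2) α)
    (h68 : CC2021_lemma_6_8_iii (-(Real.log 2 / 2)) (Real.log 2 / 2) α d)
    (hTr : ∀ g : ℝ → ℂ, IsWeilTest g → tsupport g ⊆ Icc (-(Real.log 2 / 2)) (Real.log 2 / 2) →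
      ∀ (n : ℕ) (ξ : Fin n → Lp ℂ 2 (volume : Measure ℝ)),
        Orthonormal ℂ ξ → (∀ i, ξ i ∈ soninSpace 1 1) →
          ∑ i, (soninTraceForm (weilConv g (weilReflect g)) (ξ i : ℝ → ℂ)).re
            ≤ (archW (weilConv g (weilReflect g))).re
              + (evenFunctional G (weilConv g (weilReflect g))).re) :
    WeilArchPositivity_soninTrace_fine :=
  weilArchPositivity_soninTrace_fine_of_opIneq hG hGe he'
    (opIneq_of_section6 neg_half_log_two_lt' hG h61 h64 h65 h68) hc hTr

/-- RH-FREE corpus theorem (archimedean place only; line 1). **Theorem 1 =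
`WeilArchPositivity_soninTrace` from (A), (B) (with `e′ > 0`, no constant needed) and the §6 inputs
(C) as printed.**  WHAT THIS IS NOT: a discharge; a statement about RH. PROVED.
[cite: ConnesConsani2021, Thm. 1 (Intro p. 4); Thm. 6.11 §6.7 pp. 28–29] -/
theorem weilArchPositivity_soninTrace_of_section6 {G : ℝ → ℂ} {e' : ℝ} {α d : ℕ → ℝ}
    (hG : ContDiff ℝ 2 G) (hGe : deriv G 0 = e') (he' : 0 < e')
    (h61 : CC2021_fact_6_1 (-(Real.log 2 / 2)) (Real.log 2 / 2) G α d)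
    (h64 : CC2021_lemma_6_4_orthogonality (-(Real.log 2 / 2)) (Real.log 2 / 2) α 1732)
    (h65 : CC2021_fact_6_5 (-(Real.log 2 / 2)) (Real.log 2 / 2) α)
    (h68 : CC2021_lemma_6_8_iii (-(Real.log 2 / 2)) (Real.log 2 / 2) α d)
    (hTr : ∀ g : ℝ → ℂ, IsWeilTest g → tsupport g ⊆ Icc (-(Real.log 2 / 2)) (Real.log 2 / 2) →
      ∀ (n : ℕ) (ξ : Fin n → Lp ℂ 2 (volume : Measure ℝ)),
        Orthonormal ℂ ξ → (∀ i, ξ i ∈ soninSpace 1 1) →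
          ∑ i, (soninTraceForm (weilConv g (weilReflect g)) (ξ i : ℝ → ℂ)).re
            ≤ (archW (weilConv g (weilReflect g))).re
              + (evenFunctional G (weilConv g (weilReflect g))).re) :
    WeilArchPositivity_soninTrace :=
  weilArchPositivity_soninTrace_of_opIneq hG hGe he'
    (opIneq_of_section6 neg_half_log_two_lt' hG h61 h64 h65 h68) hTr

/-! ## Discharge of Lemma 6.6 (the `(log Γ)''` form of the Parseval tails) -/

/-- The trigamma series converges for `x > 0` and sums to `trigammaSum x`. [folklore] -/
private theorem hasSum_trigammaSum {x : ℝ} (hx : 0 < x) :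
    HasSum (fun j : ℕ ↦ 1 / (x + j) ^ 2) (trigammaSum x) := by
  have hs : Summable (fun j : ℕ ↦ 1 / (x + j) ^ 2) := by
    refine ((Real.summable_one_div_nat_add_rpow x 2).2 one_lt_two).congr fun j ↦ ?_
    rw [abs_of_pos (by positivity), Real.rpow_two, add_comm]
  exact hs.hasSum

/-- The summand of the Parseval tail for `|k| ≥ n > |α|`:
`sinc(π(α − k))² = π^{−2} sin²(πα) · (k − α)^{−2}` ("`sin²(π(a − n)) = sin²(πa)`", proof of Lemma 6.6).
[cite: ConnesConsani2021, Lemma 6.6 §6.6 p. 25 (proof)] -/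
private theorem sinc_sq_eq_of_ne {α : ℝ} {k : ℤ} (hne : α - k ≠ 0) :
    Real.sinc (π * (α - k)) ^ 2 = π⁻¹ ^ 2 * Real.sin (π * α) ^ 2 * (1 / ((k : ℝ) - α) ^ 2) := by
  have hπ : (π : ℝ) ≠ 0 := Real.pi_ne_zero
  rw [Real.sinc_of_ne_zero (mul_ne_zero hπ hne), show π * (α - k) = π * α - k * π by ring,
    Real.sin_sub_int_mul_pi, div_pow, mul_pow, ← sq_abs ((-1 : ℝ) ^ k), abs_neg_one_zpow,
    one_pow, one_mul]
  have hk : (π * α - k * π) ^ 2 = π ^ 2 * ((k : ℝ) - α) ^ 2 := by ring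
  rw [hk]
  have hne' : ((k : ℝ) - α) ^ 2 ≠ 0 := pow_ne_zero 2 (fun h ↦ hne (by linarith))
  field_simp

/-- **Connes–Consani 2021, Lemma 6.6 — DISCHARGED** (`CC2021_lemma_6_6_holds : CC2021_lemma_6_6`):
from the Parseval step `‖ξ_α − P(n)ξ_α‖² = Σ_{|k|≥n} sinc(π(α−k))²` (`hasSum_sinc_sq_norm_sub_proj`)
by the printed re-indexing of the two tails `k ≥ n` and `k ≤ −n` into the series
`Σ_{j≥0}(n−α+j)^{−2}` and `Σ_{j≥0}(α+n+j)^{−2}` ("One then uses the identity, for `a < n` …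
Similarly for `−n < a` …", p. 25). PROVED. [cite: ConnesConsani2021, Lemma 6.6 §6.6 p. 25] -/
theorem CC2021_lemma_6_6_holds : CC2021_lemma_6_6 := by
  intro a b n α hab hsum hα
  obtain ⟨hαl, hαr⟩ := hα
  have hL : 0 < b - a := sub_pos.2 hab
  have hP := hasSum_sinc_sq_norm_sub_proj hL n α
  rw [show (b - a) / 2 = b by linarith] at hP
  rw [show -b = a by linarith] at hP
  -- notation
  set c : ℝ := π⁻¹ ^ 2 * Real.sin (π * α) ^ 2 with hc
  set F : ℤ → ℝ := fun k ↦ Real.sinc (π * (α - k)) ^ 2 with hF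
  have hn : 0 < n := by
    have : (0 : ℝ) < n := by linarith
    exact_mod_cast this
  -- the summand on the tail
  have hpt : ∀ k : ℤ, (n : ℤ) ≤ |k| → F k = c * (1 / ((k : ℝ) - α) ^ 2) := by
    intro k hk
    have hne : α - k ≠ 0 := by
      intro h0
      have hkR : (n : ℝ) ≤ |(k : ℝ)| := by exact_mod_cast hk
      have : |α| < n := abs_lt.2 ⟨hαl, hαr⟩
      rw [show α = k by linarith] at this
      linarith
    exact sinc_sq_eq_of_ne hne
  -- indicator form of the Parseval identity
  have hP' : HasSum ({k : ℤ | (n : ℤ) ≤ |k|}.indicator F)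
      (‖expVector a b α - ∑ j ∈ Finset.Ioo (-(n : ℤ)) n, expProj a b j (expVector a b α)‖ ^ 2) :=
    hasSum_subtype_iff_indicator.1 hP
  -- the two tails
  set G₁ : ℤ → ℝ := {k : ℤ | (n : ℤ) ≤ k}.indicator F with hG₁
  set G₂ : ℤ → ℝ := {k : ℤ | k ≤ -(n : ℤ)}.indicator F with hG₂
  have hsplit : {k : ℤ | (n : ℤ) ≤ |k|}.indicator F = G₁ + G₂ := by
    funext k
    simp only [hG₁, hG₂, Pi.add_apply, Set.indicator_apply, Set.mem_setOf_eq]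
    by_cases h1 : (n : ℤ) ≤ k
    · have h2 : ¬ k ≤ -(n : ℤ) := by omega
      have h3 : (n : ℤ) ≤ |k| := h1.trans (le_abs_self k)
      rw [if_pos h3, if_pos h1, if_neg h2, add_zero]
    · by_cases h2 : k ≤ -(n : ℤ)
      · have h3 : (n : ℤ) ≤ |k| := by
          rw [abs_of_nonpos (by omega)]
          omega
        rw [if_pos h3, if_neg h1, if_pos h2, zero_add]
      · have h3 : ¬ (n : ℤ) ≤ |k| := not_le.2 (abs_lt.2 ⟨by omega, by omega⟩)
        rw [if_neg h3, if_neg h1, if_neg h2, add_zero]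
  -- tail `k ≥ n`: `Σ_{j≥0} (n − α + j)^{−2}`
  have hT₁ : HasSum G₁ (c * trigammaSum (n - α)) := by
    have hi : Function.Injective (fun j : ℕ ↦ (n : ℤ) + j) := fun j₁ j₂ h ↦ by
      simpa using h
    have h0 : ∀ x ∉ Set.range (fun j : ℕ ↦ (n : ℤ) + j), G₁ x = 0 := by
      intro x hx
      have hxn : ¬ (n : ℤ) ≤ x := by
        intro hle
        exact hx ⟨(x - n).toNat, by
          show (n : ℤ) + (((x - n).toNat : ℕ) : ℤ) = x
          rw [Int.toNat_of_nonneg (sub_nonneg.2 hle)]; ring⟩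
      simp only [hG₁, Set.indicator_apply, Set.mem_setOf_eq, if_neg hxn]
    refine (hi.hasSum_iff h0).1 ?_
    have hfun : (G₁ ∘ fun j : ℕ ↦ (n : ℤ) + j) = fun j : ℕ ↦ c * (1 / ((n : ℝ) - α + j) ^ 2) := by
      funext j
      simp only [Function.comp_apply, hG₁, Set.indicator_apply, Set.mem_setOf_eq]
      rw [if_pos (by omega), hpt _ (by rw [abs_of_nonneg (by omega)]; omega)]
      push_cast
      ring
    rw [hfun]
    exact (hasSum_trigammaSum (by linarith)).mul_left c
  -- tail `k ≤ −n`: `Σ_{j≥0} (α + n + j)^{−2}`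
  have hT₂ : HasSum G₂ (c * trigammaSum (α + n)) := by
    have hi : Function.Injective (fun j : ℕ ↦ -(n : ℤ) - j) := fun j₁ j₂ h ↦ by
      have h' : (j₁ : ℤ) = j₂ := by
        have := h
        simp only at this
        linarith
      exact_mod_cast h'
    have h0 : ∀ x ∉ Set.range (fun j : ℕ ↦ -(n : ℤ) - j), G₂ x = 0 := by
      intro x hx
      have hxn : ¬ x ≤ -(n : ℤ) := by
        intro hle
        exact hx ⟨(-(n : ℤ) - x).toNat, by
          show -(n : ℤ) - (((-(n : ℤ) - x).toNat : ℕ) : ℤ) = x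
          rw [Int.toNat_of_nonneg (by omega)]; ring⟩
      simp only [hG₂, Set.indicator_apply, Set.mem_setOf_eq, if_neg hxn]
    refine (hi.hasSum_iff h0).1 ?_
    have hfun : (G₂ ∘ fun j : ℕ ↦ -(n : ℤ) - j) = fun j : ℕ ↦ c * (1 / (α + n + j) ^ 2) := by
      funext j
      simp only [Function.comp_apply, hG₂, Set.indicator_apply, Set.mem_setOf_eq]
      rw [if_pos (by omega), hpt _ (by rw [abs_of_nonpos (by omega)]; omega)]
      push_cast
      ring
    rw [hfun]
    exact (hasSum_trigammaSum (by linarith)).mul_left c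
  have hsum2 : HasSum ({k : ℤ | (n : ℤ) ≤ |k|}.indicator F)
      (c * trigammaSum (n - α) + c * trigammaSum (α + n)) := by
    rw [hsplit]
    exact hT₁.add hT₂
  rw [hP'.unique hsum2]
  ring

/-! ## Discharge of Lemma 6.4: the closed form of `h(k)` and the sampling identity

The printed proof ("`⟨ξ_{α_n}|ψ⟩ = (log 2)^{−1/2} h(α_n) = 0`", Fourier inversion for the band-limited
`h`) becomes, for `ψ` in its expansion on `(ξ_k)`, the identity `Σ_{|k|≤m} h(k) sinc(π(k − α_n)) = 0`.
We prove it from (1) the closed form `h(k) = P(k)·(m!)²/((m−|k|)!(m+|k|)!)`, `P(z) = ∏_{j≤m}(1 − z²/α_j²)`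
(Euler's telescoping tail `∏_{n>m}(1 − k²/n²)`), and (2) the vanishing of the `2m`-th finite difference
of the polynomial `q(y) = P(y − m − β… )/(y − β − m)` of degree `< 2m` (Mathlib's
`Polynomial.fwdDiff_iter_eq_zero_of_degree_lt`), which is the partial-fraction content of the sampling
theorem at a zero `β` of `P`. -/

section EulerTail

/-- `(a + k)! = a! · ∏_{i<k} (a + 1 + i)` (as reals). [folklore] -/
private theorem factorial_add_eq_mul_prod (a k : ℕ) :
    ((a + k).factorial : ℝ) = a.factorial * ∏ i ∈ Finset.range k, ((a : ℝ) + 1 + i) := by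
  induction k with
  | zero => simp
  | succ k ih =>
    rw [Finset.prod_range_succ, ← mul_assoc, ← ih, show a + (k + 1) = (a + k) + 1 by ring,
      Nat.factorial_succ, Nat.cast_mul]
    push_cast
    ring

/-- Partial products of the Euler tail in closed form (`d = m − k`): `∏_{j<N}(1 − k²/(d+k+1+j)²)
= ((d+k)!)²(d+N)!(d+2k+N)!/(d!(d+2k)!((d+k+N)!)²)` (telescoping). [folklore] -/
private theorem prod_range_euler_tail (d k N : ℕ) :
    ∏ j ∈ Finset.range N, (1 - (k : ℝ) ^ 2 / ((d : ℝ) + k + 1 + j) ^ 2)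
      = ((d + k).factorial : ℝ) ^ 2 * (d + N).factorial * (d + 2 * k + N).factorial
          / (d.factorial * (d + 2 * k).factorial * ((d + k + N).factorial : ℝ) ^ 2) := by
  induction N with
  | zero =>
    rw [Finset.prod_range_zero, add_zero, add_zero, add_zero]
    have h1 : (d.factorial : ℝ) ≠ 0 := by positivity
    have h2 : ((d + 2 * k).factorial : ℝ) ≠ 0 := by positivity
    have h3 : ((d + k).factorial : ℝ) ≠ 0 := by positivity
    rw [eq_div_iff (by positivity)]
    ring
  | succ N ih =>
    rw [Finset.prod_range_succ, ih]
    have e1 : ((d + (N + 1)).factorial : ℝ) = ((d : ℝ) + N + 1) * (d + N).factorial := by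
      rw [show d + (N + 1) = (d + N) + 1 by ring, Nat.factorial_succ]; push_cast; ring
    have e2 : ((d + 2 * k + (N + 1)).factorial : ℝ)
        = ((d : ℝ) + 2 * k + N + 1) * (d + 2 * k + N).factorial := by
      rw [show d + 2 * k + (N + 1) = (d + 2 * k + N) + 1 by ring, Nat.factorial_succ]; push_cast; ring
    have e3 : ((d + k + (N + 1)).factorial : ℝ) = ((d : ℝ) + k + N + 1) * (d + k + N).factorial := by
      rw [show d + k + (N + 1) = (d + k + N) + 1 by ring, Nat.factorial_succ]; push_cast; ring
    rw [e1, e2, e3]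
    have h1 : (d.factorial : ℝ) ≠ 0 := by positivity
    have h2 : ((d + 2 * k).factorial : ℝ) ≠ 0 := by positivity
    have h3 : ((d + k + N).factorial : ℝ) ≠ 0 := by positivity
    have h4 : ((d : ℝ) + k + N + 1) ≠ 0 := by positivity
    have h5 : ((d : ℝ) + k + 1 + N) ≠ 0 := by positivity
    field_simp
    ring

/-- The factorial ratio `(d+N)!(d+2k+N)!/((d+k+N)!)² = ∏_{i<k}(1 + k/(d+N+1+i)) → 1`. [folklore] -/
private theorem tendsto_euler_tail_ratio (d k : ℕ) :
    Tendsto (fun N : ℕ ↦ ((d + N).factorial : ℝ) * (d + 2 * k + N).factorial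
      / ((d + k + N).factorial : ℝ) ^ 2) atTop (nhds 1) := by
  have hform : ∀ N : ℕ, ((d + N).factorial : ℝ) * (d + 2 * k + N).factorial
      / ((d + k + N).factorial : ℝ) ^ 2
        = ∏ i ∈ Finset.range k, (((d : ℝ) + k + N + 1 + i) / ((d : ℝ) + N + 1 + i)) := by
    intro N
    have h1 := factorial_add_eq_mul_prod (d + k + N) k
    have h2 := factorial_add_eq_mul_prod (d + N) k
    rw [show d + 2 * k + N = d + k + N + k by ring, h1, show d + k + N = d + N + k by ring, h2,
      Finset.prod_div_distrib]
    have hne : ((d + N).factorial : ℝ) ≠ 0 := by positivity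
    have hne2 : ∏ i ∈ Finset.range k, ((((d + N : ℕ) : ℝ)) + 1 + i) ≠ 0 :=
      Finset.prod_ne_zero_iff.2 fun i _ ↦ by positivity
    push_cast at hne2 ⊢
    field_simp
    ring
  simp_rw [hform]
  have hlim : ∀ i ∈ Finset.range k, Tendsto (fun N : ℕ ↦ ((d : ℝ) + k + N + 1 + i) / ((d : ℝ) + N + 1 + i))
      atTop (nhds 1) := by
    intro i _
    have hden : Tendsto (fun N : ℕ ↦ (d : ℝ) + N + 1 + i) atTop atTop := by
      have : Tendsto (fun N : ℕ ↦ (N : ℝ) + ((d : ℝ) + 1 + i)) atTop atTop :=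
        tendsto_atTop_add_const_right _ _ tendsto_natCast_atTop_atTop
      refine this.congr fun N ↦ by ring
    have hk : Tendsto (fun N : ℕ ↦ (k : ℝ) / ((d : ℝ) + N + 1 + i)) atTop (nhds 0) :=
      tendsto_const_nhds.div_atTop hden
    have : Tendsto (fun N : ℕ ↦ 1 + (k : ℝ) / ((d : ℝ) + N + 1 + i)) atTop (nhds (1 + 0)) :=
      tendsto_const_nhds.add hk
    rw [add_zero] at this
    refine this.congr fun N ↦ ?_
    have hpos : ((d : ℝ) + N + 1 + i) ≠ 0 := by positivity
    field_simp
    ring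
  have := tendsto_finsetProd (Finset.range k) hlim
  simpa using this

/-- **The Euler tail product**: `∏_{n>m} (1 − k²/n²) = (m!)²/((m−k)!(m+k)!)` for `k ≤ m` — the tail
of the product "defining `sin(πz)/(πz)`" by which `h` is "convergent likewise" (§6.5 p. 25), at an
integer `k`, where it telescopes: `∏_{n=m+1}^{M}(n−k)(n+k)/n² = m!²(M−k)!(M+k)!/((m−k)!(m+k)!M!²)`.
PROVED (classical; Euler). [cite: ConnesConsani2021, §6.5 p. 25 (the product defining `h`, "convergent likewise the product defining `sin(πz)/(πz)`")] -/
theorem hasProd_euler_tail {m k : ℕ} (hk : k ≤ m) :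
    HasProd (fun j : ℕ ↦ 1 - (k : ℝ) ^ 2 / ((m : ℝ) + 1 + j) ^ 2)
      ((m.factorial : ℝ) ^ 2 / ((m - k).factorial * (m + k).factorial)) := by
  obtain ⟨d, rfl⟩ : ∃ d, m = d + k := ⟨m - k, (Nat.sub_add_cancel hk).symm⟩
  rw [Nat.add_sub_cancel]
  have hmult : Multipliable (fun j : ℕ ↦ 1 - (k : ℝ) ^ 2 / (((d + k : ℕ) : ℝ) + 1 + j) ^ 2) := by
    have hs : Summable (fun j : ℕ ↦ ‖-((k : ℝ) ^ 2 / (((d + k : ℕ) : ℝ) + 1 + j) ^ 2)‖) := by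
      have h0 := ((Real.summable_one_div_nat_add_rpow (((d + k : ℕ) : ℝ) + 1) 2).2 one_lt_two).mul_left
        ((k : ℝ) ^ 2)
      refine h0.congr fun j ↦ ?_
      have hpos : (0 : ℝ) < (j : ℝ) + ((((d + k : ℕ) : ℝ)) + 1) := by positivity
      rw [norm_neg, norm_div, norm_pow, norm_pow, Real.norm_natCast, Real.norm_eq_abs,
        abs_of_pos (by positivity : (0 : ℝ) < ((d + k : ℕ) : ℝ) + 1 + j), abs_of_pos hpos,
        Real.rpow_two]
      ring
    simpa [sub_eq_add_neg] using multipliable_one_add_of_summable hs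
  have hlim := hmult.hasProd.tendsto_prod_nat
  have hclosed : ∀ N : ℕ, ∏ j ∈ Finset.range N, (1 - (k : ℝ) ^ 2 / (((d + k : ℕ) : ℝ) + 1 + j) ^ 2)
      = ((d + k).factorial : ℝ) ^ 2 / (d.factorial * (d + 2 * k).factorial) *
        (((d + N).factorial : ℝ) * (d + 2 * k + N).factorial / ((d + k + N).factorial : ℝ) ^ 2) := by
    intro N
    have := prod_range_euler_tail d k N
    push_cast at this ⊢
    rw [this]
    have h1 : (d.factorial : ℝ) ≠ 0 := by positivity
    have h2 : ((d + 2 * k).factorial : ℝ) ≠ 0 := by positivity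
    have h3 : ((d + k + N).factorial : ℝ) ≠ 0 := by positivity
    field_simp
  have hlim2 : Tendsto (fun N : ℕ ↦ ∏ j ∈ Finset.range N,
      (1 - (k : ℝ) ^ 2 / (((d + k : ℕ) : ℝ) + 1 + j) ^ 2)) atTop
      (nhds (((d + k).factorial : ℝ) ^ 2 / (d.factorial * (d + 2 * k).factorial) * 1)) := by
    simp_rw [hclosed]
    exact tendsto_const_nhds.mul (tendsto_euler_tail_ratio d k)
  have huniq := tendsto_nhds_unique hlim hlim2
  rw [mul_one, show d + 2 * k = d + k + k by ring] at huniq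
  rw [← huniq]
  exact hmult.hasProd


end EulerTail

/-- `∏_{j=1}^{m} g(j) = ∏_{i<m} g(i+1)`. [folklore] -/
private theorem prod_Icc_one_eq_prod_range {M' : Type*} [CommMonoid M'] (g : ℕ → M') (m : ℕ) :
    ∏ n ∈ Finset.Icc 1 m, g n = ∏ i ∈ Finset.range m, g (i + 1) := by
  induction m with
  | zero => simp
  | succ k ih => rw [Finset.prod_Icc_succ_top (Nat.le_add_left 1 k), ih, Finset.prod_range_succ]

/-- **The closed form of `h` at the integers `0 ≤ k ≤ m`**: `h(k) = P(k) · (m!)²/((m−k)!(m+k)!)` with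
`P(k) = ∏_{j=1}^{m} (1 − k²/α_j²)` (the finite part of the product) and the Euler tail
`∏_{n>m}(1 − k²/n²) = (m!)²/((m−k)!(m+k)!)` (`hasProd_euler_tail`). PROVED.
[cite: ConnesConsani2021, Lemma 6.4 §6.5 p. 25 (proof: "`h` … is the product of `sin(πz)/(πz)` by a rational fraction")] -/
theorem hProd_natCast_of_le {α : ℕ → ℝ} {m k : ℕ} (hk : k ≤ m) :
    hProd α m k = (∏ j ∈ Finset.Icc 1 m, (1 - (k : ℝ) ^ 2 / α j ^ 2))
      * ((m.factorial : ℝ) ^ 2 / ((m - k).factorial * (m + k).factorial)) := by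
  have hfun : (fun j : ℕ ↦ hFactor α m k (j + m)) = fun j : ℕ ↦ 1 - (k : ℝ) ^ 2 / ((m : ℝ) + 1 + j) ^ 2 := by
    funext j
    have hlt : m < j + m + 1 := by omega
    show 1 - (k : ℝ) ^ 2 / ccAngle α m (j + m + 1) ^ 2 = 1 - (k : ℝ) ^ 2 / ((m : ℝ) + 1 + j) ^ 2
    rw [ccAngle_of_lt hlt]
    push_cast
    ring_nf
  have htail : HasProd (fun j : ℕ ↦ hFactor α m k (j + m))
      ((m.factorial : ℝ) ^ 2 / ((m - k).factorial * (m + k).factorial)) := by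
    rw [hfun]
    exact hasProd_euler_tail hk
  have hfull := htail.prod_range_mul
  unfold hProd
  rw [hfull.tprod_eq, prod_Icc_one_eq_prod_range]
  congr 1
  refine Finset.prod_congr rfl fun i hi ↦ ?_
  have him : i + 1 ≤ m := Nat.succ_le_of_lt (Finset.mem_range.1 hi)
  show 1 - (k : ℝ) ^ 2 / ccAngle α m (i + 1) ^ 2 = 1 - (k : ℝ) ^ 2 / α (i + 1) ^ 2
  rw [ccAngle_of_le him]

/-- The closed form of `h` on the integer window `|k| ≤ m`, indexed by `i = k + m ∈ [0, 2m]`: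
`h(i − m) = P(i − m) · ((m!)²/(2m)!) · binom(2m, i)`. PROVED. [folklore] -/
private theorem hProd_sub_eq {α : ℕ → ℝ} {m i : ℕ} (hi : i ≤ 2 * m) :
    hProd α m ((i : ℝ) - m) = (∏ j ∈ Finset.Icc 1 m, (1 - ((i : ℝ) - m) ^ 2 / α j ^ 2))
      * ((m.factorial : ℝ) ^ 2 / (2 * m).factorial * ((2 * m).choose i : ℝ)) := by
  have hchoose : ((2 * m).choose i : ℝ) * (i.factorial * (2 * m - i).factorial) = (2 * m).factorial := by
    rw [← mul_assoc]
    exact_mod_cast Nat.choose_mul_factorial_mul_factorial hi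
  have hc0 : ((2 * m).choose i : ℝ) ≠ 0 := by exact_mod_cast (Nat.choose_pos hi).ne'
  have hfi : (i.factorial : ℝ) ≠ 0 := by positivity
  have hf2 : ((2 * m - i).factorial : ℝ) ≠ 0 := by positivity
  have hf3 : ((2 * m).factorial : ℝ) ≠ 0 := by positivity
  rcases le_or_gt i m with him | him
  · -- `i ≤ m`: `i − m = −(m − i)`
    have hk : m - i ≤ m := Nat.sub_le m i
    have hcast : ((i : ℝ) - m) = -(((m - i : ℕ) : ℝ)) := by
      rw [Nat.cast_sub him]; ring
    rw [hcast, hProd_neg, hProd_natCast_of_le hk, show m - (m - i) = i by omega,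
      show m + (m - i) = 2 * m - i by omega]
    congr 1
    · refine Finset.prod_congr rfl fun j _ ↦ ?_
      rw [neg_sq]
    · rw [← hchoose]
      field_simp
  · -- `m < i`: `i − m = (i − m : ℕ)`
    have hk : i - m ≤ m := by omega
    have hcast : ((i : ℝ) - m) = (((i - m : ℕ) : ℝ)) := by
      rw [Nat.cast_sub him.le]
    rw [hcast, hProd_natCast_of_le hk, show m - (i - m) = 2 * m - i by omega,
      show m + (i - m) = i by omega]
    congr 1
    rw [← hchoose]
    field_simp

/-- The Gram matrix on a SYMMETRIC window `[a, b]`, `a + b = 0`: `⟨ξ_β|ξ_γ⟩ = sinc(π(γ − β))`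
(`inner_expVector_expVector_symm` transported). PROVED. [cite: ConnesConsani2021, Lemma 6.6 §6.6 p. 25 (proof)] -/
theorem inner_expVector_expVector_of_symm (hab : a < b) (hsym : a + b = 0) (β γ : ℝ) :
    ⟪expVector a b β, expVector a b γ⟫_ℂ = ((Real.sinc (π * (γ - β)) : ℝ) : ℂ) := by
  have hL : 0 < b - a := sub_pos.2 hab
  have h := inner_expVector_expVector_symm hL β γ
  rw [show (b - a) / 2 = b by linarith] at h
  rw [show -b = a by linarith] at h
  exact h

/-- `⟨ξ_β|ψ⟩ = L^{−1/2} Σ_{|k|≤m} h(k) sinc(π(k − β))` on a symmetric window — the expansion of `ψ` on the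
orthonormal basis paired with `ξ_β`. PROVED. [cite: ConnesConsani2021, Lemma 6.4 §6.5 p. 25 (proof)] -/
theorem inner_expVector_ccPsi (hab : a < b) (hsym : a + b = 0) (α : ℕ → ℝ) (m : ℕ) (β : ℝ) :
    ⟪expVector a b β, ccPsi a b α m⟫_ℂ = (((Real.sqrt (b - a))⁻¹ : ℝ) : ℂ) *
      ∑ k ∈ Finset.Icc (-(m : ℤ)) m, ((hProd α m k * Real.sinc (π * (k - β)) : ℝ) : ℂ) := by
  rw [ccPsi, inner_smul_right, inner_sum]
  congr 1
  refine Finset.sum_congr rfl fun k _ ↦ ?_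
  rw [inner_smul_right, inner_expVector_expVector_of_symm hab hsym, ← Complex.ofReal_mul]

/-- Re-indexing the integer window: `Σ_{k=−m}^{m} F(k) = Σ_{i=0}^{2m} F(i − m)`. [folklore] -/
private theorem sum_Icc_neg_eq_sum_range (F : ℤ → ℝ) (m : ℕ) :
    ∑ k ∈ Finset.Icc (-(m : ℤ)) m, F k = ∑ i ∈ Finset.range (2 * m + 1), F ((i : ℤ) - m) := by
  have himage : Finset.Icc (-(m : ℤ)) m = (Finset.range (2 * m + 1)).image (fun i : ℕ ↦ (i : ℤ) - m) := by
    ext k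
    simp only [Finset.mem_Icc, Finset.mem_image, Finset.mem_range]
    constructor
    · rintro ⟨h1, h2⟩
      exact ⟨(k + m).toNat, by omega, by omega⟩
    · rintro ⟨i, hi, rfl⟩
      constructor <;> omega
  rw [himage, Finset.sum_image fun i _ j _ h ↦ by simpa using h]

/-- The sign pattern of `sinc` on the integer window, for `β + m − i ≠ 0` (`x = β + m`):
`sinc(π((i − m) − β)) = (−1)^i sin(π(β + m)) / (π (x − i))`. PROVED. [folklore] -/
private theorem sinc_shift_eq {β : ℝ} {m i : ℕ} (hne : β + m - i ≠ 0) :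
    Real.sinc (π * ((((i : ℤ) - m : ℤ) : ℝ) - β))
      = (-1) ^ i * Real.sin (π * (β + m)) / (π * (β + m - i)) := by
  have hπ : (π : ℝ) ≠ 0 := Real.pi_ne_zero
  have hne' : π * ((((i : ℤ) - m : ℤ) : ℝ) - β) ≠ 0 := by
    push_cast
    refine mul_ne_zero hπ ?_
    intro h; exact hne (by linarith)
  rw [Real.sinc_of_ne_zero hne']
  push_cast
  rw [show π * ((i : ℝ) - m - β) = i * π - π * (β + m) by ring, Real.sin_nat_mul_pi_sub,
    show (i : ℝ) * π - π * (β + m) = -(π * (β + m - i)) by ring, neg_div_neg_eq]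

/-- **The sampling identity at a zero of `P`** (the partial-fraction content of "`⟨ξ_{α_n}|ψ⟩ =
L^{−1/2} h(α_n) = 0`"): if `β ∉ ℤ` and `P(β) = ∏_{j≤m}(1 − β²/α_j²) = 0`, then
`Σ_{|k|≤m} h(k) sinc(π(k − β)) = 0`.  Proof: with `x = β + m`, `p(y) = P(y − m)` has the root `x`,
`p = (X − x)q` with `deg q < 2m`, `h(i − m) = P(i − m)(m!)²/(2m)!·binom(2m,i)`, and the `2m`-th
forward difference `Σ_i (−1)^i binom(2m,i) q(i)` of `q` vanishes. PROVED.
[cite: ConnesConsani2021, Lemma 6.4 §6.5 p. 25 (proof)] -/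
theorem sum_hProd_mul_sinc_eq_zero {α : ℕ → ℝ} {m : ℕ} (hm : 1 ≤ m) {β : ℝ}
    (hβ : ∀ k : ℤ, β ≠ k) (hP : ∏ j ∈ Finset.Icc 1 m, (1 - β ^ 2 / α j ^ 2) = 0) :
    ∑ k ∈ Finset.Icc (-(m : ℤ)) m, hProd α m k * Real.sinc (π * (k - β)) = 0 := by
  open Polynomial in
  -- the polynomial `P` and its shift `p(y) = P(y − m)`
  set Pp : ℝ[X] := ∏ j ∈ Finset.Icc 1 m, (C 1 - C ((α j ^ 2)⁻¹) * X ^ 2) with hPp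
  have hPeval : ∀ y : ℝ, Pp.eval y = ∏ j ∈ Finset.Icc 1 m, (1 - y ^ 2 / α j ^ 2) := by
    intro y
    rw [hPp, Polynomial.eval_prod]
    refine Finset.prod_congr rfl fun j _ ↦ ?_
    rw [Polynomial.eval_sub, Polynomial.eval_C, Polynomial.eval_mul, Polynomial.eval_C,
      Polynomial.eval_pow, Polynomial.eval_X, div_eq_mul_inv, mul_comm ((α j ^ 2)⁻¹)]
  have hPdeg : Pp.natDegree ≤ 2 * m := by
    refine (Polynomial.natDegree_prod_le _ _).trans ?_
    have h2 : ∀ j ∈ Finset.Icc 1 m, (C 1 - C ((α j ^ 2)⁻¹) * X ^ 2 : ℝ[X]).natDegree ≤ 2 := by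
      intro j _
      refine (Polynomial.natDegree_sub_le _ _).trans (max_le (by simp) ?_)
      exact (Polynomial.natDegree_C_mul_le _ _).trans (by simp)
    calc ∑ j ∈ Finset.Icc 1 m, (C 1 - C ((α j ^ 2)⁻¹) * X ^ 2 : ℝ[X]).natDegree
        ≤ ∑ j ∈ Finset.Icc 1 m, 2 := Finset.sum_le_sum h2
      _ = 2 * m := by simp [mul_comm]
  set x : ℝ := β + m with hx
  set p : ℝ[X] := Pp.comp (X - C (m : ℝ)) with hp
  have hpeval : ∀ y : ℝ, p.eval y = ∏ j ∈ Finset.Icc 1 m, (1 - (y - m) ^ 2 / α j ^ 2) := by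
    intro y
    rw [hp, Polynomial.eval_comp, Polynomial.eval_sub, Polynomial.eval_X, Polynomial.eval_C, hPeval]
  have hpdeg : p.natDegree ≤ 2 * m := by
    refine Polynomial.natDegree_comp_le.trans ?_
    rw [Polynomial.natDegree_X_sub_C, mul_one]
    exact hPdeg
  have hroot : p.IsRoot x := by
    rw [Polynomial.IsRoot, hpeval, hx, add_sub_cancel_right, hP]
  set q : ℝ[X] := p /ₘ (X - C x) with hq
  have hpq : (X - C x) * q = p := Polynomial.mul_divByMonic_eq_iff_isRoot.2 hroot
  have hqeval : ∀ y : ℝ, p.eval y = (y - x) * q.eval y := by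
    intro y
    rw [← hpq, Polynomial.eval_mul, Polynomial.eval_sub, Polynomial.eval_X, Polynomial.eval_C]
  have hqdeg : q.natDegree < 2 * m := by
    by_cases hq0 : q = 0
    · rw [hq0, Polynomial.natDegree_zero]; omega
    · have h := Polynomial.natDegree_mul (Polynomial.X_sub_C_ne_zero x) hq0
      rw [hpq, Polynomial.natDegree_X_sub_C] at h
      omega
  -- the `2m`-th forward difference of `q` at `0` vanishes
  have hfd : ∑ i ∈ Finset.range (2 * m + 1), (-1 : ℝ) ^ i * ((2 * m).choose i : ℝ) * q.eval (i : ℝ) = 0 := by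
    have h0 := congr_fun (Polynomial.fwdDiff_iter_eq_zero_of_degree_lt hqdeg) 0
    rw [fwdDiff_iter_eq_sum_shift, Pi.zero_apply] at h0
    rw [← h0]
    refine Finset.sum_congr rfl fun i hi ↦ ?_
    have hi' : i ≤ 2 * m := by simpa [Finset.mem_range, Nat.lt_add_one_iff] using hi
    rw [zsmul_eq_mul, zero_add, nsmul_eq_mul, mul_one]
    push_cast
    have hsign : ((-1 : ℝ) ^ (2 * m - i)) = (-1) ^ i := by
      have h1 : ((-1 : ℝ) ^ (2 * m - i)) * (-1) ^ i = 1 := by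
        rw [← pow_add, Nat.sub_add_cancel hi', pow_mul, neg_one_sq, one_pow]
      have h2 : ((-1 : ℝ) ^ i) * (-1) ^ i = 1 := by rw [← pow_add, ← two_mul, pow_mul, neg_one_sq, one_pow]
      calc ((-1 : ℝ) ^ (2 * m - i)) = (-1) ^ (2 * m - i) * ((-1) ^ i * (-1) ^ i) := by rw [h2, mul_one]
        _ = ((-1) ^ (2 * m - i) * (-1) ^ i) * (-1) ^ i := by ring
        _ = (-1) ^ i := by rw [h1, one_mul]
    rw [hsign]
  -- rewrite the window sum through `i = k + m`
  rw [sum_Icc_neg_eq_sum_range (fun k : ℤ ↦ hProd α m k * Real.sinc (π * (k - β))) m]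
  have hxi : ∀ i : ℕ, β + m - i ≠ 0 := by
    intro i h
    exact hβ ((i : ℤ) - m) (by push_cast; linarith)
  have hterm : ∀ i ∈ Finset.range (2 * m + 1),
      hProd α m ((((i : ℤ) - m : ℤ)) : ℝ) * Real.sinc (π * ((((i : ℤ) - m : ℤ) : ℝ) - β))
        = -((m.factorial : ℝ) ^ 2 / (2 * m).factorial * Real.sin (π * (β + m)) / π)
          * ((-1 : ℝ) ^ i * ((2 * m).choose i : ℝ) * q.eval (i : ℝ)) := by
    intro i hi
    have hi' : i ≤ 2 * m := by simpa [Finset.mem_range, Nat.lt_add_one_iff] using hi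
    rw [sinc_shift_eq (hxi i)]
    have hcast : ((((i : ℤ) - m : ℤ)) : ℝ) = (i : ℝ) - m := by push_cast; ring
    rw [hcast, hProd_sub_eq hi', ← hpeval]
    rw [hqeval]
    have hπ : (π : ℝ) ≠ 0 := Real.pi_ne_zero
    have hxne : (β + m - i : ℝ) ≠ 0 := hxi i
    rw [hx]
    field_simp
    ring
  rw [Finset.sum_congr rfl hterm, ← Finset.mul_sum, hfd, mul_zero]

/-- If `P(β) = 0` then `⟨ξ_β|ψ⟩ = 0` on a symmetric window — both cases: `β ∈ ℤ` (then `h(β) = 0`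
directly, a factor of the product vanishing) and `β ∉ ℤ` (`sum_hProd_mul_sinc_eq_zero`). PROVED.
[cite: ConnesConsani2021, Lemma 6.4 §6.5 p. 25 (proof)] -/
theorem inner_expVector_ccPsi_eq_zero_of_root (hab : a < b) (hsym : a + b = 0) {α : ℕ → ℝ}
    {m : ℕ} (hm : 1 ≤ m) {β : ℝ} (hP : ∏ j ∈ Finset.Icc 1 m, (1 - β ^ 2 / α j ^ 2) = 0) :
    ⟪expVector a b β, ccPsi a b α m⟫_ℂ = 0 := by
  by_cases hint : ∃ k : ℤ, β = k
  · obtain ⟨k, rfl⟩ := hint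
    rw [inner_expVector_intCast_ccPsi hab]
    -- a factor of the product `h(k)` vanishes
    obtain ⟨j, hj, hj0⟩ := Finset.prod_eq_zero_iff.1 hP
    have hjm : 1 ≤ j ∧ j ≤ m := Finset.mem_Icc.1 hj
    have hz : hProd α m k = 0 := by
      refine tprod_of_exists_eq_zero ⟨j - 1, ?_⟩
      rw [hFactor, show j - 1 + 1 = j by omega, ccAngle_of_le hjm.2]
      exact hj0
    rw [hz, Complex.ofReal_zero, mul_zero]
  · have hint' : ∀ k : ℤ, β ≠ k := fun k hk ↦ hint ⟨k, hk⟩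
    rw [inner_expVector_ccPsi hab hsym, ← Complex.ofReal_sum, sum_hProd_mul_sinc_eq_zero hm hint' hP,
      Complex.ofReal_zero, mul_zero]

/-- **Connes–Consani 2021, Lemma 6.4 — DISCHARGED** (`CC2021_lemma_6_4_holds : CC2021_lemma_6_4`):
`ψ ⊥ ξ_{±α_n}` for `1 ≤ n ≤ m` on every symmetric window, from `P(±α_n) = 0` (`α_n ≠ 0`) and the
sampling identity. Hence `Tψ = λψ` unconditionally (`opT_ccPsi`, `opT_ccZeta`). PROVED.
[cite: ConnesConsani2021, Lemma 6.4 §6.5 p. 25] -/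
theorem CC2021_lemma_6_4_holds : CC2021_lemma_6_4 := by
  intro a b α m hab hsym hα n hn1 hnm
  have hm : 1 ≤ m := hn1.trans hnm
  have hroot : ∀ β : ℝ, β ^ 2 = α n ^ 2 → ∏ j ∈ Finset.Icc 1 m, (1 - β ^ 2 / α j ^ 2) = 0 := by
    intro β hβ
    exact Finset.prod_eq_zero (Finset.mem_Icc.2 ⟨hn1, hnm⟩)
      (by rw [hβ, div_self (pow_ne_zero 2 (hα n hn1 hnm)), sub_self])
  exact ⟨inner_expVector_ccPsi_eq_zero_of_root hab hsym hm (hroot _ rfl),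
    inner_expVector_ccPsi_eq_zero_of_root hab hsym hm (hroot _ (neg_sq _))⟩


/-- **`Tζ = λζ` unconditionally on a symmetric window** (Lemma 6.4 discharged): for non-zero angles
`α_1, …, α_m`, the unit vector `ζ = ψ/‖ψ‖` is an eigenvector of `T = opT a b λ α d m` with eigenvalue
`λ` — the binder `heig` of `MainInequalityAssembly.weilArchPositivity_soninTrace_fine_of_spectralData`
fact-free. PROVED. [cite: ConnesConsani2021, Lemma 6.4 §6.5 p. 25; §6.7 p. 28] -/
theorem opT_ccZeta_of_symm (hab : a < b) (hsym : a + b = 0) {α : ℕ → ℝ} {m : ℕ}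
    (hα : ∀ n : ℕ, 1 ≤ n → n ≤ m → α n ≠ 0) (lam : ℝ) (d : ℕ → ℝ) :
    opT a b lam α d m (ccZeta a b α m) = ((lam : ℝ) : ℂ) • ccZeta a b α m :=
  opT_ccZeta hab (CC2021_lemma_6_4_holds a b α m hab hsym hα) lam d

/-- RH-FREE corpus theorem (archimedean place only; line 1). **Eq. (4) / Theorem 6.11 from (A), (B)
and the three NUMERICAL-IN-PRINT inputs only** (Fact 6.1, Fact 6.5, Lemma 6.8 (iii)), Lemma 6.4 being
now a theorem: the remaining condition on the data is the explicit `α_n ≠ 0` (`1 ≤ n ≤ 1732`).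
WHAT THIS IS NOT: a discharge of the fact; a statement about RH. PROVED.
[cite: ConnesConsani2021, eq. (4) p. 4; Thm. 6.11 §6.7 pp. 28–29; Lemma 6.4 p. 25; Lemma 6.10 p. 28] -/
theorem weilArchPositivity_soninTrace_fine_of_section6' {G : ℝ → ℂ} {e' : ℝ} {α d : ℕ → ℝ}
    (hG : ContDiff ℝ 2 G) (hGe : deriv G 0 = e') (he' : 0 < e')
    (hc : 8 * 0.064 * e' / Real.log 2 < 17) (hα : ∀ n : ℕ, 1 ≤ n → n ≤ 1732 → α n ≠ 0)
    (h61 : CC2021_fact_6_1 (-(Real.log 2 / 2)) (Real.log 2 / 2) G α d)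
    (h65 : CC2021_fact_6_5 (-(Real.log 2 / 2)) (Real.log 2 / 2) α)
    (h68 : CC2021_lemma_6_8_iii (-(Real.log 2 / 2)) (Real.log 2 / 2) α d)
    (hTr : ∀ g : ℝ → ℂ, IsWeilTest g → tsupport g ⊆ Icc (-(Real.log 2 / 2)) (Real.log 2 / 2) →
      ∀ (n : ℕ) (ξ : Fin n → Lp ℂ 2 (volume : Measure ℝ)),
        Orthonormal ℂ ξ → (∀ i, ξ i ∈ soninSpace 1 1) →
          ∑ i, (soninTraceForm (weilConv g (weilReflect g)) (ξ i : ℝ → ℂ)).re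
            ≤ (archW (weilConv g (weilReflect g))).re
              + (evenFunctional G (weilConv g (weilReflect g))).re) :
    WeilArchPositivity_soninTrace_fine :=
  weilArchPositivity_soninTrace_fine_of_section6 hG hGe he' hc h61
    (CC2021_lemma_6_4_holds _ _ α 1732 neg_half_log_two_lt' (by ring) hα) h65 h68 hTr

/-- RH-FREE corpus theorem (archimedean place only; line 1). **Theorem 1 from (A), (B) and the three
NUMERICAL-IN-PRINT inputs only** (with `α_n ≠ 0`). WHAT THIS IS NOT: a discharge; a statement about
RH. PROVED. [cite: ConnesConsani2021, Thm. 1 (Intro p. 4); Thm. 6.11 §6.7 pp. 28–29; Lemma 6.4 p. 25] -/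
theorem weilArchPositivity_soninTrace_of_section6' {G : ℝ → ℂ} {e' : ℝ} {α d : ℕ → ℝ}
    (hG : ContDiff ℝ 2 G) (hGe : deriv G 0 = e') (he' : 0 < e')
    (hα : ∀ n : ℕ, 1 ≤ n → n ≤ 1732 → α n ≠ 0)
    (h61 : CC2021_fact_6_1 (-(Real.log 2 / 2)) (Real.log 2 / 2) G α d)
    (h65 : CC2021_fact_6_5 (-(Real.log 2 / 2)) (Real.log 2 / 2) α)
    (h68 : CC2021_lemma_6_8_iii (-(Real.log 2 / 2)) (Real.log 2 / 2) α d)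
    (hTr : ∀ g : ℝ → ℂ, IsWeilTest g → tsupport g ⊆ Icc (-(Real.log 2 / 2)) (Real.log 2 / 2) →
      ∀ (n : ℕ) (ξ : Fin n → Lp ℂ 2 (volume : Measure ℝ)),
        Orthonormal ℂ ξ → (∀ i, ξ i ∈ soninSpace 1 1) →
          ∑ i, (soninTraceForm (weilConv g (weilReflect g)) (ξ i : ℝ → ℂ)).re
            ≤ (archW (weilConv g (weilReflect g))).re
              + (evenFunctional G (weilConv g (weilReflect g))).re) :
    WeilArchPositivity_soninTrace :=
  weilArchPositivity_soninTrace_of_section6 hG hGe he' h61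
    (CC2021_lemma_6_4_holds _ _ α 1732 neg_half_log_two_lt' (by ring) hα) h65 h68 hTr

end Literature.NumberTheory.ConnesConsani2021

end
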